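import Literature.MathematicalPhysics.QuantumFieldTheory.Balaban1983to89.B12Eq338CondIV
import Literature.MathematicalPhysics.QuantumFieldTheory.Balaban1983to89.B12Lemma4DataInstance
import Literature.MathematicalPhysics.QuantumFieldTheory.Balaban1983to89.B12Eq117Concrete
import Mathlib.Analysis.CStarAlgebra.Basic
import Literature.MathematicalPhysics.QuantumFieldTheory.Balaban1983to89.B12Eq311RemainderBound

/-!
# `Balaban1983to89.B12Eq115BackgroundPair` — T. Bałaban, *Renormalization group approach to lattice gauge field theories. I*,
Commun. Math. Phys. **109** (1987) 249–301 [Balaban1987RG1], (1.15) p. 262: **the pair `(U_n(M˙(𝐔)), J_n(M˙(𝐔)))` ASSEMBLED —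
its J-half is print's own definition «by the formula (1.8) with U_n(M˙(𝐔)) instead of U_j, L⁻ⁿ instead of ξ», now a kernel
DEFINITION on the carrier of record (`B12RegularSpaces111.BackgroundFns`) instead of a free datum.**

HONEST FRAMING (cell `lit-balaban`, verbatim): statement-level skeleton of published theorems with citation tags; proofs where landed; nothing here is a claim about the Yang–Mills mass gap.

PDF held: `paper:balaban1987-cmp109-rg-i-small-field` (journal page = PDF page + 248); p. 262 = PDF 14 re-read by this unit on the
text layer (`lit read … --pages 14`, lines 23–33) and on the render `b2b-balaban-ref1/pages/1987-cmp109-rg-I-small-field/…-p014-x2.png`.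

THE PRINT, verbatim (p. 262, condition (iv)).  *«(iv) We consider X as Ω₀, and we construct the sequence {Ω_n}, n = 1, …, j, of
maximal possible domains satisfying the conditions (1.3)–(1.6) [14] (with j, ξ instead of k, η, R = R₁). For this sequence, or
rather for its subsequences {Ω₀, Ω₁, …, Ω_n}, n = 1, …, j, we construct the functions U_n(V) in the axial gauges, for regular
Gᶜ-valued configurations V. We consider the pair (U_n(M˙(𝐔)), J_n(M˙(𝐔))), n = 1, …, j, (1.15) where M˙(𝐔, b) = M^p(𝐔, b) = Ū^p(b)
for b ∈ Λ_p (see (1.5) [14]), and J_n(M˙(𝐔)) is defined by the formula (1.8) with U_n(M˙(𝐔)) instead of U_j, L⁻ⁿ instead of ξ.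
This pair satisfies the bounds |∂U_n(M˙(𝐔)) − 1| < α₀ξ², |J_n(M˙(𝐔))| < α₀(Lⁿξ)² on X̃⁻², (1.16) and the same bounds hold for U
instead of 𝐔.»*

WHY THIS FILE.  The carrier of record for (1.15)–(1.16) (p07, `B12RegularSpaces111`, p245800) holds the pair (1.15) as the free
datum `BackgroundFns = ⟨Un, Jn⟩` inside `Frame.bg` — BOTH halves data — and (1.16) with body as `CondIV bg X̃⁻² c α₀ V`.  The
display owner's audit of row B12.Eq1.15-1.16 (r09 g40, HEAD QUESTION B12-Q7, HOME/INBOX 2026-08-23T07:54:30Z) names ONE point: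
*«the defining sentence of (1.15) … is a (b)-type identification that the tree holds ONLY as the free datum `BackgroundFns` … the
owed member is an assembled `BackgroundFns` instance»*.  Print's sentence has two halves of different standing:
* the **U-half** `𝐔 ↦ U_n(M˙(𝐔))` is BY REFERENCE to [14] (1.3)–(1.6)/(1.5) (maximal domains `Ω_n`, multi-level averages
  `M˙ = Ū^p` on `Λ_p`) and to [15] (the axial-gauge minimizers `U_n(V)` «for regular Gᶜ-valued configurations V», i.e. their
  analytic continuation, [15] Sect. F / Prop. 9) — the tree carries these constructions in their own blocks (B8 rows
  `Setup.Averaging.iter`, B8.Eq1.3-1.6; B11 `Setup.Background`, `IsBackground`), on carriers that DO NOT MEET this one: B11's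
  `Background.U : GaugeField P k G → GaugeField P 0 G` is `G`-valued and runs across torus levels, `BackgroundFns P i 𝔸` is
  `Gᶜ ⊆ 𝔸ˣ`-valued at one level (r09's audit (a), confirmed here by reading both carriers).  This half therefore STAYS DATA
  (`Un`), exactly where print's own parametric chain bottoms out (in [14]/[15]);
* the **J-half** is NOT by reference: print DEFINES `J_n(M˙(𝐔))` from the U-half by its own formula (1.8) at the parameter `L⁻ⁿ`.
  The tree has (1.8) with body (`B12Eq18Current.current π ξ 𝐔`, p07 p247446) and the parameter change made explicit
  (`B12Eq338CondIV.current_scale`, p07 g6 p255998), but no object tying `Jn` to `Un`.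
THIS module supplies that object and nothing more: `pairOf π c Un := ⟨Un, fun n V ↦ current π (L ^ n)⁻¹ (Un n V)⟩`.

WHAT IS DEFINED AND PROVED (one `def` with body + theorems; no `Prop` placeholder, no new fact, no sorry; axioms standard).
§1 `pairOf` (the assembled pair (1.15)) with `pairOf_Un`, `pairOf_Jn`, `pairOf_Jn_apply` (simp/rfl); **`eq_pairOf_of_Jn`** (a
   `BackgroundFns` whose J-half IS (1.8)-at-`L⁻ⁿ` of its U-half is `pairOf` of its U-half — the definition is forced);
   **`echoBg_eq_pairOf`**: r20 g10's (iv)-datum of the non-vacuity instance `B12Lemma4DataInstance.echoBg c` (U-half the identity,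
   `π = id`) IS `pairOf LinearMap.id c (fun _ V ↦ V)` (`rfl`) — the one assembled instance the tree already had, now an instance of
   the general construction.
§2 (1.16) for the assembled pair: **`condIV_pairOf_iff`** — `CondIV (pairOf π c Un) X̃⁻² c α₀ V` ↔ the two printed bounds on the
   configurations `U_n(M˙(V))` ALONE (`|∂U_n(M˙(V)) − 1| < α₀ξ²` and `|J_{L⁻ⁿ}(U_n(M˙(V)))| < α₀(Lⁿξ)²` on `X̃⁻²`, `1 ≤ n ≤ j`);
   `norm_pairOf_Jn_eq` (`|J_n(M˙(V))(b)| = (Lⁿξ)³·|J_ξ(U_n(M˙(V)))(b)|`, the parameter change of (1.8), `current_scale` BY NAME);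
   **`condIV_pairOf_of_current_lt`**: the J-bound of (1.16) with its exponent `2` FOLLOWS from a (iii)-type bound (1.14)
   `|J_ξ(U_n(M˙(V)))| < α₀` at the parameter `ξ` on each `U_n(M˙(V))`, because «L⁻ⁿ instead of ξ» costs `(Lⁿξ)³ ≤ (Lⁿξ)²`
   (`0 < Lⁿξ ≤ 1` for `n ≤ j`, `B12Eq338CondIV.scale_pow_le_one`).
§3 (iv) from (iii) for the assembled pair under (3.38): **`condIV_pairOf_of_eq338`** / **`condIV_one_pairOf_of_eq338`** = p07's
   `B12Eq338CondIV.condIV_of_eq338` / `condIV_one_of_eq338` BY NAME, with their hypothesis `hJn` («J_n(M˙(V))(b) = ((1.8) at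
   L⁻ⁿ)(V^{w_n})(b)», the (1.15) definition sentence composed with (3.38)) DISCHARGED by the definition: what remains assumed is
   (3.38) p. 278 itself, as the printed CONFIGURATION identity `U_n(X, M˙(V)) = V^{u_j(ū_j)⁻¹}` (`h338 : Un n V = gaugeU (w n) V`,
   `1 ≤ n ≤ j`) — print states (3.38) as an identity of functions, so the plaquette-level and bond-level instances p07 assumed
   separately (`h338`, `hJn`) are both consequences (`plaq_pairOf_eq_of_eq338`, `pairOf_Jn_eq_of_eq338`).
§4 (v1.1) (i)–(iv) for the Lemma-4 pair `(exp iξ𝐊, 𝐉)` on a frame whose (iv)-datum obeys the (1.15) definition sentence: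
   `bg_eq_pairOf_of_Jdef`; **`satisfies_expI_of_eq338_of_Jdef`** = p07's `B12Eq338CondIV.satisfies_expI_of_eq338` (his (3.36)/(3.38)
   mechanism, twenty hypotheses) with the (1.15) sentence `hJdef : F.bg.Jn n V = current π (L^n)⁻¹ (F.bg.Un n V)` as a property of the
   frame and, of his four (3.38)-hypotheses, ONLY the two printed configuration identities left (`U_n(X, M˙(exp iξ𝐊)) = (exp iξ𝐊)^{w_n}`,
   `U_n(X, M˙(1)) = 1^{w₁,n}`) — the two bond-level `J`-instances `hJn`, `hJn₁` are consequences; **`satisfies_expI_pairOf_of_eq338`**: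
   the same on the assembled frame `⟨X, cubes, X̃⁻², pairOf π c Un⟩` (`hJdef` by `rfl`).
NOT here (by reference, as in every Lemma-4 file): the functions `U_n(X, M˙(·))` of [14, 15], `u_j`, `ū_j`, the identity (3.38)
itself, the (iii)-type bounds with the better constants.  Row B12.Eq1.15-1.16 (display owner r09, fold owner r20): located member,
CELLS ONLY, no head change claimed (lead g12 HEAD WORD B12-Q7, HOME/STATUS 2026-08-23T08:24:18Z: the identification of `Frame.bg`
with print's composite is OWED AT B12.Eq1.17 — this file is its J-half; the U-half carrier bridge is recorded in
`lit-balaban-r20/B12-CLOSURE.md` §5 (f)).  Unit `lit-balaban-r20` (B12 fold owner / DEFINITIONS steward, gen 42; TAKING line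
HOME/STATUS.md 2026-08-23T08:16:30Z, cc r09 / p07; v1.0 p358411 ACCEPTED 7dfae5345bbe; v1.1 = APPEND-ONLY §4, v1.0 declarations
byte-identical), HOME `run/shared/lean/pub/lit-balaban/`.

v1.2 (gen 49, APPEND-ONLY; §§1–4 byte-identical; one import added, `B12Eq117Concrete`, for p07's membership theorems): §5 = THE
U-HALF ASSEMBLED AND (1.17) DERIVED AT PRINT'S SEAM, under the lead's HEAD WORD **B12-Q22** (HOME/STATUS 2026-08-24T03:22:00Z,
YES-WITH-ELEMENTS (α)–(γ); r09 joint position CONCUR 03:14Z).  (β) DATA YES, AXIOM NO: the structure **`UHalf P G 𝔸 av`** EXTENDS the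
tree's `Setup.Background P G av` (B11: the minimisers `V ↦ U_n(V)` as data with `IsBackground`) by the inclusion `ι : G →* 𝔸ˣ`
(injective; the value clause (1.10)) and by print's two intermediate objects CARRIED AS DATA, PINNED ON THE `G`-VALUED FIELDS — the
continuation of the MINIMISER `extU n : (PBond P n → 𝔸ˣ) → (PBond P 0 → 𝔸ˣ)` ([15] Prop. 9 p. 309, first clause: *«The minimal
configuration U_k(V) … has an extension to an analytic function of Gᶜ-valued small configurations V′»*), `extU_real : extU n (ι ∘ W) =
ι ∘ U n W`, and the average `M˙ = M^n` on `𝔸ˣ`-valued fields `extM n : (PBond P 0 → 𝔸ˣ) → (PBond P n → 𝔸ˣ)` ((1.5) [14] ∕ (0.11)),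
`extM_real : extM n (ι ∘ 𝐔) = ι ∘ Averaging.iter av n 𝐔` (located modelling note: `Setup.Averaging` is a `[GaugeGroup G]`-structure and
does not instantiate at `𝔸ˣ`); NO existence ∕ analyticity field ([15]'s theorems, rows B11.Prop9 ∕ B11.Thm1, by reference) —
**`UHalf.exists_of_background`**: every `Background` with an injective `ι` extends to a `UHalf` (junk off `G`), so nothing beyond B11's
data is asserted.  **`UHalf.bgOf D π c := pairOf π c (fun n V ↦ extU n (extM n V))`** = the (iv)-datum (1.15) of print's instance (J-half
by §1), `UHalf.frame` = `⟨X, cubes, X̃⁻², bgOf⟩`; THE IDENTIFICATION is now a THEOREM of the pinnings: **`bgOf_Un_real`** ∕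
**`bgOf_Jn_real`** (`(bgOf).Un n (ι∘𝐔) = ι ∘ U_n(M^n 𝐔)` — B11's `Background.U n` of B8's `Averaging.iter av n` — and `(bgOf).Jn n (ι∘𝐔) =
(1.8)_{L⁻ⁿ}(ι ∘ U_n(M^n 𝐔))`), `extU_real_isBackground` ∕ `bgOf_Un_real_isBackground` (on B11's domain the U-half is a constrained
minimiser, `IsBackground` by name).  (α) CUT AT PRINT'S SEAM, NOT AT (1.17): **`eq117_of_inputs`** PROVES p07's hypothesis shape `h117`
of `B12Eq117Concrete` — (1.17) for the datum `bgOf`, both lines, every `1 ≤ n ≤ j`, on `X̃⁻²`, for every `V` with `|∂V − 1| < α₀′ξ²` on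
`X` — from two NAMED inputs in their rows' shapes plus thresholds: (E1) `hP9` = the [15] regularity of the [15]-functions `U_n(·) =
extU n` ALONE, `ε₁` FREE (`∀ ε₁, 0 < ε₁ ≤ a₁`, every `W` on `T⁽ⁿ⁾` with `|∂W − 1| < ε₁(Lⁿξ)²` on `Λ_n`: `|∂U_n(W) − 1| < B₃ε₁L⁻²ⁿ(Lⁿξ)²`
and `|J_n(W)| < B₃ε₁(Lⁿξ)²` on `X̃⁻²`, `J_n(W) := (1.8)_{L⁻ⁿ}(U_n(W))`; [15] Thm 1 (9)–(10) p. 279 ∕ Sect. F p. 300 ∕ Prop. 9 p. 309 ← rows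
B11.Prop9 · B11.Thm1 ∕ B11.Eq169 BY REFERENCE; no `M˙` inside; the J-line in print's (1.17) shape — «From Proposition 9 [15] we
obtain» both lines — the (10) → (1.8) passage not proved here); (E2) `havg` = «M˙(𝐔) = Ū^p on Λ_p» by definition (`extM`; (1.5) [14],
row B8.Eq1.5) and «|∂Ū^p − 1| < 2α₀′(L^pξ)²» from `|∂𝐔 − 1| < α₀′ξ²` = [12] Prop. 2 (54) p. 26 in printed shape, `α₀` FREE («α₀ ≤ c₂ …
|Ū^k(∂p) − 1| < α₀ + 2C₀α₀² < 2α₀») ← row B7.Prop2 BY REFERENCE (`B7.Prop2Printed`; the `ℤᵈ`-carrier proof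
`B7Prop2Explicit.prop2_explicit_lt_two` does not meet the abstract `Setup.Averaging`, which has no formula); thresholds «for α₀′
sufficiently small»: `0 < α₀′ ≤ c₂`, `2α₀′ ≤ a₁` (and `2B₃α₀′ ≤ α₀` for (iv)).  Then `eq117_of_inputs'` (printed right-hand side
`2B₃α₀′ξ²`, `B12Eq117Membership.eq117_scale`), **`condIV_bgOf_of_inputs`** ((1.17) ⇒ (iv)), and the membership paragraph ON PRINT'S
INSTANCE with `h117` DISCHARGED: **`mem_space_frame_of_inputs`**, `setOf_satisfiesI_III_frame_subset_space` (p07's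
`mem_space_of_prop9Shape` BY NAME, fed the theorem), and p. 263's LAST SENTENCE **`minimal_mem_space'_of_inputs`**: B11's minimal
configuration `ι ∘ U_j(V)` with its current (1.9) lies in `U^c_j(X, α₀, α₁)` given condition (i) for it ((1.11) ∕ (1.12) = B11 Thm 1
outputs, hypotheses), `|𝐉| < α₀′`, `0 < α₁′`, and (E1) ∕ (E2) ∕ thresholds (p07's `ofBackground_mem_space'_of_prop9Shape` BY NAME).
HONEST SCOPE of §5: `extU` ∕ `extM` off the `G`-valued fields are NOT constructed ([15] Sect. F as an object is B11's lane; the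
Gᶜ-average likewise); (E1), (E2) are hypotheses in their source rows' shapes, not asserted; one-level carrier — (E1) and (E2) meet on
the top layer `Λ_n ⊂ T⁽ⁿ⁾` (`Λ : (n : ℕ) → Set (Plaq P n)` geometry data; print's lower layers `Λ_p`, `p < n`, are the located
simplification of this carrier, v2.153); B11's `Background` constrains the top-level average only (`IsBackground`: `M^k(U₀) = V`);
the finest lattice is `Setup` level `0` (print's `T_ξ`).  §5 = 1 structure + 2 defs with bodies (`bgOf`, `frame`) + 23 theorems + 1
private lemma; 0 facts; axioms standard (`propext`, `Classical.choice`, `Quot.sound`).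

v1.3 (gen 50, APPEND-ONLY; §§1–5 byte-identical; two imports added, `Mathlib.Analysis.CStarAlgebra.Basic` for the C⋆-norm identity
`|Y*| = |Y|` and `B12Eq311RemainderBound` for [I]'s (3.11) expansion of the current): §§6–10 = THE CURRENT BOUND FROM [14] (1.9) FOR
`G`-VALUED (UNITARY-VALUED) CONFIGURATIONS, and three printed sentences that follow from it AT PRINT'S SEAM; §11 = THE COMPLEX SECTOR
(§5's `hP9` DERIVED from the [15] §G representation, below).  THE ROUTE is [15]'s own, (28) p. 282: *«J = D*η⁻²Im ∂U₀ = Im η⁻²D*∂U₀, |J| < C₁B₃ε₁(Lʲη)⁻³ on Ω_j,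
(28) the bound holds by the assumption (14)»* ((14) = «U₀ ∈ 𝔘_k({Ω_j}, C₁B₃ε₁)») — Theorem 1 [15] clause (8) p. 279 (*«there exists a
minimal orbit in the space 𝔘_k({Ω_j}, B₃ε₁) ∩ 𝔅_k(𝔅_k, V)»*) places the minimiser in a space whose DEFINITION, [14] =
[Balaban1985RegularSpaces] (1.7) ∕ (1.9) p. 77 (*«|U(∂p) − 1| < α₀L^{−2j} for p ∈ Ω_j … (1.7) … |(D^{η*}_U ∂U)(b)| < α₀L^{−2j}(Lʲη)⁻¹ for
b ∈ Ω_j, j = 0, 1, …, k. (1.9)»*), bounds the covariant divergence of the plaquette field; for a unitary-valued configuration `Im` is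
the LINEAR map `Y ↦ (Y − Y*)∕2i` on the (unitary) plaquette variables and, like the `Ad`-equivariant projection `π` of (1.8), commutes
with the transports `R(U(b)⁻¹)` of `D^{η*}_U` ((1.11) [14]); so **`J(b) = ξ⁻² π Im (D^{ξ*}_U ∂U)(b)`** and **`|J(b)| ≤ C_π ξ⁻² |(D^{ξ*}_U
∂U)(b)|`**.  §6 algebra (`covDstar_map`, `divP_map`, `divPη_map`, `divPη_linearMap`, `divPη_smul'`); §7 star (`star_R_inv`,
`val_plaqU_mem_unitary`, `imC_eq_imPart`, `imPart_R_inv`, `star_real_inv_smul`, **`divPη_imC_plaqU_eq`** = the identity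
of (28)); §7′ norm (`norm_imPart_le`, `norm_divPη_imC_plaqU_le`, **`norm_J_le_of_unitary`** for the current (3.11) ∕ (28) without `π`,
`B9Eq39Adjoint.J`); §8 torus (**`current_eq_smul_map`**, **`norm_current_le_of_unitary`** for (1.8) `B12Eq18Current.current`); §9 THE
«⇐» CLAIM OF (1.2) p. 260 — *«|U(∂p) − 1| < ε₀η² … |J| < ε₀ on T … is implied by the condition on V, with 2ε₀ replaced by B₃⁻¹ε₀, see
Theorem 1 [15]»* — **`eq12_of_membership`** (a unitary-valued `U` in the clause-(8) space at the top level `Lᵏη = 1` satisfies (1.2)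
with `(α, C_π α)`), **`eq12_of_thm1`** ∕ `eq12_of_thm1'` (the sentence for B11's minimiser `Background.U k V` read through a
unitary-valued `ι : G →* 𝔸ˣ`, INPUT `hThm1` = Theorem 1 [15] in the shape «(7) `PlaqSmall ε₁ V`, `0 < ε₁ ≤ a₁` ⇒ (1.7) ∧ (1.9) for
`ι ∘ U_k(V)` with `α₀ = B₃ε₁`» BY REFERENCE (rows B11.Thm1, B8.Eq1.7-1.9), OUTPUT (1.2) with `ε₀ = B₃ε₁` for every `V` with
`PlaqSmall (B₃⁻¹ε₀) V`, `0 < ε₀ ≤ B₃a₁`; `C_π ≤ 1` gives print's `ε₀` on the nose), **`mem_regularSpace_of_thm1`** (the same as membership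
in `Setup.RegularSpace P k ε₀`, the object of row B12.Eq1.2, when `dist1 g ≤ |ι g − 1|`); §10 over `UHalf`:
**`UHalf.minimal_mem_space'_of_membership`** = p. 263's last sentence with the hypothesis `hJ` of `minimal_mem_space'_of_inputs`
DISCHARGED from the (1.9)-membership of `ι ∘ U_j(V)` at the top level (`|(D^{ξ*}∂U_j(V))(b)| < α₀′ξ²` on `X`), and
**`UHalf.eq117_real_of_membership`** ∕ `…'` = BOTH LINES of (1.17) «for U instead of 𝐔» ((1.16): the `G`-valued factor) at
`V = ι ∘ 𝐔_g`, from (E1ʳ) the clause-(8) shape for B11's OWN minimiser `Background.U n` — NO continuation, NO J-line hypothesis — and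
(E2ʳ) [12] Prop. 2 for `G`-valued fields (`Averaging.iter av n` by name), plus the thresholds of §5; J-line `|J_n| < C_π·B₃2α₀′(Lⁿξ)²`
(`= B₃2α₀′(Lⁿξ)²` for `C_π ≤ 1`).  §11 THE COMPLEX SECTOR: **`UHalf.hP9_of_prop9Shape`** — §5's (E1) `hP9` (both lines of (1.17)
for the [15]-function `extU n W`, `ε₁` free) is a THEOREM given the [15] §G REPRESENTATION of the continuation (p. 305 (172)–(173),
Prop. 9 p. 309: *«We take U₀ = U_k(V₀) … we fix the Landau gauge for the configuration U_k(V′V₀)U₀⁻¹ = U₁, and we have U₁ = exp iη𝓗(B),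
𝓗 satisfies the conditions (19)–(21) with ε₂ = … = B₅ε₁. (173)»*): hypothesis `hrep` = for every admissible `(ε₁, n, W)`,
`extU n W = (e^{iηA}·U₀)^u` (`gaugeU u (sub310 η A U₀)`, `η = L⁻ⁿ`) with `U₀` unitary-valued in the clause-(8) space at the top level
((1.7), (1.9) with `B₃ε₁(Lⁿξ)²`), `A` obeying (19) at the top level with `ε₂ = B₅ε₁(Lⁿξ)²` (`|A|`, `|∇^η_{U₀}A|` = `B12RegularSpaces111.nabla`,
`|D^{η*}_{U₀}D^η_{U₀}A|`), `u` the axial ↔ Landau re-gauging with `|u|, |u⁻¹| ≤ ρ_u`, `π` commuting with the transports of `U₀` and `u`;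
conclusion = `hP9` with the EXPLICIT constant `K = ρ_u²(C_π(B₃ + B₅ + (d − 1)C_F(1)B₅) + (2B₅ + 8e⁴B₅ + e⁴B₃)) + 1` for print's generic `B₃`
— first line by the plaquette expansion of `e^{iηA}U₀` ([14] (1.26), `B12Eq311LatticeBounds.norm_plaq_prodCfg_sub_one_le`), J-line by
(3.11) `J(e^{iηA}U₀) = J(U₀) + D^{η*}_{U₀}πD^η_{U₀}A + 𝐅(U₀, A)` (`B12Eq311CurrentExpansion.eq311_current`) with §8 for `J(U₀)` ([15] (28)),
`norm_lapCur_le`, and `B12Eq311RemainderBound.norm_rem311_le_linear` for `𝐅`, both lines transported by `u`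
(`norm_plaq_gaugeU_sub_one_le`, `norm_current_gaugeU_le`); thresholds `1 ≤ L`, `0 < ξ`, `Lⁿξ ≤ 1`, `B₃a₁ ≤ 1`, `B₅a₁ ≤ 1`; and
**`UHalf.eq117_of_prop9Shape`** = §5's `eq117_of_inputs` BY NAME fed the theorem: (1.17) for `bgOf` with NO (1.17)-shaped hypothesis.
HONEST SCOPE of §§6–11: §§6–10 are for UNITARY values (`G ⊂ U(N)`, p. 252; `[StarRing 𝔸] [CStarRing 𝔸] [StarModule ℂ 𝔸]` as in
`B12RegularSpaces111Unitary`); in §11 what stays BY REFERENCE is exactly [15]'s: the existence of the continuation and its §G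
representation with (173) (rows B11.Prop9 · B11.Thm1), [14]'s definition (B8.Eq1.7-1.9), and — inside `hrep`'s antecedent, as it was
inside `hP9`'s — the passage «M˙(𝐔) = V′V₀ with |V′ − 1| < C₁ε₁» of print's «From Proposition 9 [15] we obtain»; `π` commutes with the
transports of the configurations at hand and `|πX| ≤ C_π|X|` (hypotheses; `C_π = 1` for `π = id`, `G = U(N)`); one-level carrier as in
§5 (the (8) ∕ (19) bounds are taken at the top level on the whole finest lattice, [14] p. 77 «we admit the case where some domains Ω_j
are equal to T_η»); `dist1 g ≤ |ι g − 1|` holds with equality in the cell's `U(N)` ∕ `SU(N)` instances; the constant `K` is ours (print's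
constants are generic).  §§6–11 = 36 theorems, 0 definitions, 0 facts; axioms standard.
-/

namespace Literature.MathematicalPhysics.QuantumFieldTheory.Balaban1983to89.B12Eq115BackgroundPair

open Literature.MathematicalPhysics.QuantumFieldTheory.Balaban1983to89
open Literature.MathematicalPhysics.QuantumFieldTheory.Balaban1983to89.B9Eq39Adjoint (R)
open Literature.MathematicalPhysics.QuantumFieldTheory.Balaban1983to89.B12RegularSpaces111
open Literature.MathematicalPhysics.QuantumFieldTheory.Balaban1983to89.B12RegularSpaces111Gauge
open Literature.MathematicalPhysics.QuantumFieldTheory.Balaban1983to89.B12Eq18Current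
open Literature.MathematicalPhysics.QuantumFieldTheory.Balaban1983to89.B12Eq338CondIV

noncomputable section

/-! ## §1. The assembled pair (1.15): `J_n(M˙(𝐔)) := ((1.8) at the parameter L⁻ⁿ)(U_n(M˙(𝐔)))` -/

section Pair

variable {P : Params} {i : ℕ} {𝔸 : Type*} [Ring 𝔸] [Algebra ℂ 𝔸]

/-- **The pair (1.15) assembled from its U-half.**  Given the functions `𝐔 ↦ U_n(M˙(𝐔))`, `n = 1, …, j` (DATA: the multi-level
averages `M˙` of (1.5) [14] composed with the axial-gauge background fields `U_n` of [15] on the maximal sequence `{Ω₀ = X, …, Ω_n}`),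
the (iv)-datum whose J-half is print's DEFINITION «J_n(M˙(𝐔)) is defined by the formula (1.8) with U_n(M˙(𝐔)) instead of U_j,
L⁻ⁿ instead of ξ»: `J_n(M˙(𝐔)) = B12Eq18Current.current π (Lⁿ)⁻¹ (U_n(M˙(𝐔)))`, `π` the projection of (1.8) onto `𝔤ᶜ`, `L = c.L`.
[cite: Balaban1987RG1, (1.15) p.262] -/
def pairOf (π : 𝔸 →ₗ[ℂ] 𝔸) (c : StepConsts) (Un : ℕ → (PBond P i → 𝔸ˣ) → PBond P i → 𝔸ˣ) : BackgroundFns P i 𝔸 :=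
  ⟨Un, fun n V => current π (c.L ^ n)⁻¹ (Un n V)⟩

/-- The U-half of the assembled pair is the given datum `𝐔 ↦ U_n(M˙(𝐔))`. [cite: Balaban1987RG1, (1.15) p.262] -/
@[simp] theorem pairOf_Un (π : 𝔸 →ₗ[ℂ] 𝔸) (c : StepConsts) (Un : ℕ → (PBond P i → 𝔸ˣ) → PBond P i → 𝔸ˣ) :
    (pairOf π c Un).Un = Un := rfl

/-- The J-half of the assembled pair: «(1.8) with U_n(M˙(𝐔)) instead of U_j, L⁻ⁿ instead of ξ». [cite: Balaban1987RG1, (1.15) p.262] -/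
@[simp] theorem pairOf_Jn (π : 𝔸 →ₗ[ℂ] 𝔸) (c : StepConsts) (Un : ℕ → (PBond P i → 𝔸ˣ) → PBond P i → 𝔸ˣ) (n : ℕ)
    (V : PBond P i → 𝔸ˣ) : (pairOf π c Un).Jn n V = current π (c.L ^ n)⁻¹ (Un n V) := rfl

/-- The J-half at a bond. [cite: Balaban1987RG1, (1.15) p.262] -/
theorem pairOf_Jn_apply (π : 𝔸 →ₗ[ℂ] 𝔸) (c : StepConsts) (Un : ℕ → (PBond P i → 𝔸ˣ) → PBond P i → 𝔸ˣ) (n : ℕ)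
    (V : PBond P i → 𝔸ˣ) (b : PBond P i) : (pairOf π c Un).Jn n V b = current π (c.L ^ n)⁻¹ (Un n V) b := rfl

/-- **The definition is forced**: a (iv)-datum `bg = ⟨U_·(M˙(·)), J_·(M˙(·))⟩` whose J-half IS «the formula (1.8) with U_n(M˙(𝐔))
instead of U_j, L⁻ⁿ instead of ξ» applied to its U-half is the pair assembled from its U-half. [cite: Balaban1987RG1, (1.15) p.262] -/
theorem eq_pairOf_of_Jn (π : 𝔸 →ₗ[ℂ] 𝔸) (c : StepConsts) (bg : BackgroundFns P i 𝔸)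
    (h : ∀ n V, bg.Jn n V = current π (c.L ^ n)⁻¹ (bg.Un n V)) : bg = pairOf π c bg.Un := by
  obtain ⟨Un, Jn⟩ := bg
  have hJ : Jn = fun n V => current π (c.L ^ n)⁻¹ (Un n V) := funext fun n => funext fun V => h n V
  subst hJ
  rfl

/-- Two assembled pairs with the same U-half on the arguments that matter have the same J-half there: `J_n(M˙(·))` depends on the
datum only through `U_n(M˙(·))`. [cite: Balaban1987RG1, (1.15) p.262] -/
theorem pairOf_Jn_congr (π : 𝔸 →ₗ[ℂ] 𝔸) (c : StepConsts) {Un Un' : ℕ → (PBond P i → 𝔸ˣ) → PBond P i → 𝔸ˣ} {n : ℕ}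
    {V V' : PBond P i → 𝔸ˣ} (h : Un n V = Un' n V') : (pairOf π c Un).Jn n V = (pairOf π c Un').Jn n V' := by
  rw [pairOf_Jn, pairOf_Jn, h]

end Pair

section Echo

variable {P : Params} {i : ℕ} {𝔸 : Type} [NormedRing 𝔸] [NormedAlgebra ℂ 𝔸]

/-- **The one assembled instance the tree already had is a `pairOf`.**  The (iv)-datum of the non-vacuity instance of Lemma 4's
package (`B12Lemma4DataInstance.echoBg c`: `U_n(M˙(V)) = V`, `J_n(M˙(V)) = J_{(Lⁿ)⁻¹}(V)` with `π = id`) is the pair (1.15) assembled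
from the identity U-half. [cite: Balaban1987RG1, (1.15) p.262] -/
theorem echoBg_eq_pairOf (c : StepConsts) :
    (B12Lemma4DataInstance.echoBg c : BackgroundFns P i 𝔸) = pairOf (LinearMap.id : 𝔸 →ₗ[ℂ] 𝔸) c (fun _ V => V) := rfl

end Echo

/-! ## §2. (1.16) for the assembled pair: two bounds on the configurations `U_n(M˙(V))` alone -/

section Bounds

variable {P : Params} {i : ℕ} {𝔸 : Type*} [NormedRing 𝔸] [NormedAlgebra ℂ 𝔸]

/-- **(1.16) for the assembled pair, unfolded**: condition (iv) of the frame `(pairOf π c Un, X̃⁻², c)` with constant `α₀` for `V`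
holds iff, for `n = 1, …, j`, `|∂U_n(M˙(V))(p) − 1| < α₀ξ²` for `p ⊂ X̃⁻²` and `|J_{L⁻ⁿ}(U_n(M˙(V)))(b)| < α₀(Lⁿξ)²` for `b ⊂ X̃⁻²`
— both bounds are on the configurations `U_n(M˙(V))`; no separate J-datum enters. [cite: Balaban1987RG1, (1.15)-(1.16) p.262] -/
theorem condIV_pairOf_iff (π : 𝔸 →ₗ[ℂ] 𝔸) (c : StepConsts) (Un : ℕ → (PBond P i → 𝔸ˣ) → PBond P i → 𝔸ˣ)
    (X₂ : Region P i) (α₀ : ℝ) (V : PBond P i → 𝔸ˣ) :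
    CondIV (pairOf π c Un) X₂ c α₀ V ↔
      (∀ n, 1 ≤ n → n ≤ c.j → ∀ p ∈ X₂.plaqs, ‖((plaq (Un n V) p : 𝔸ˣ) : 𝔸) - 1‖ < α₀ * c.ξ ^ 2) ∧
      (∀ n, 1 ≤ n → n ≤ c.j → ∀ b ∈ X₂.bonds, ‖current π (c.L ^ n)⁻¹ (Un n V) b‖ < α₀ * (c.L ^ n * c.ξ) ^ 2) :=
  ⟨fun h => ⟨h.plaq_lt, h.J_lt⟩, fun h => ⟨h.1, h.2⟩⟩

/-- **«L⁻ⁿ instead of ξ» as a factor**: `|J_n(M˙(V))(b)| = (Lⁿξ)³·|J_ξ(U_n(M˙(V)))(b)|` — the J-half of the assembled pair at a bond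
is the current (1.8) of `U_n(M˙(V))` at the parameter `ξ`, rescaled (`ξ / L⁻ⁿ = Lⁿξ`; `B12Eq338CondIV.norm_current_scale`).
[cite: Balaban1987RG1, (1.15) p.262] -/
theorem norm_pairOf_Jn_eq (π : 𝔸 →ₗ[ℂ] 𝔸) {c : StepConsts} (hξ : 0 < c.ξ) (hL : 0 < c.L)
    (Un : ℕ → (PBond P i → 𝔸ˣ) → PBond P i → 𝔸ˣ) (n : ℕ) (V : PBond P i → 𝔸ˣ) (b : PBond P i) :
    ‖(pairOf π c Un).Jn n V b‖ = (c.L ^ n * c.ξ) ^ 3 * ‖current π c.ξ (Un n V) b‖ := by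
  have hsn : 0 < (c.L ^ n)⁻¹ := inv_pos.mpr (pow_pos hL n)
  rw [pairOf_Jn_apply, norm_current_scale π hsn hξ (Un n V) b, div_inv_eq_mul, mul_comm c.ξ]

/-- **The exponent `2` of (1.16) from the parameter change.**  If each `U_n(M˙(V))`, `n = 1, …, j`, obeys on `X̃⁻²` the plaquette
bound `|∂U_n(M˙(V)) − 1| < α₀ξ²` and the (iii)-type current bound (1.14) AT THE PARAMETER `ξ`, `|J_ξ(U_n(M˙(V)))| < α₀`, then the
assembled pair satisfies (1.16): «L⁻ⁿ instead of ξ» multiplies the current by `(Lⁿξ)³ ≤ (Lⁿξ)²` (`0 < Lⁿξ ≤ 1` for `n ≤ j`, since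
`ξ = L⁻ʲ`, `L ≥ 1`). [cite: Balaban1987RG1, (1.15)-(1.16) p.262] -/
theorem condIV_pairOf_of_current_lt (π : 𝔸 →ₗ[ℂ] 𝔸) {c : StepConsts} (hξ : 0 < c.ξ) (hL : 1 ≤ c.L)
    (hLξ : c.L ^ c.j * c.ξ = 1) {Un : ℕ → (PBond P i → 𝔸ˣ) → PBond P i → 𝔸ˣ} {X₂ : Region P i} {α₀ : ℝ}
    {V : PBond P i → 𝔸ˣ}
    (hplaq : ∀ n, 1 ≤ n → n ≤ c.j → ∀ p ∈ X₂.plaqs, ‖((plaq (Un n V) p : 𝔸ˣ) : 𝔸) - 1‖ < α₀ * c.ξ ^ 2)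
    (hJ : ∀ n, 1 ≤ n → n ≤ c.j → ∀ b ∈ X₂.bonds, ‖current π c.ξ (Un n V) b‖ < α₀) :
    CondIV (pairOf π c Un) X₂ c α₀ V := by
  refine ⟨hplaq, fun n hn hnj b hb => ?_⟩
  have hL0 : 0 < c.L := by linarith
  obtain ⟨hr0, hr1⟩ := scale_pow_le_one hξ hL hLξ hnj
  have hJb := hJ n hn hnj b hb
  have hα₀ : 0 < α₀ := (norm_nonneg _).trans_lt hJb
  have hr2 : 0 < (c.L ^ n * c.ξ) ^ 2 := by positivity
  have hr32 : (c.L ^ n * c.ξ) ^ 3 ≤ (c.L ^ n * c.ξ) ^ 2 := by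
    calc (c.L ^ n * c.ξ) ^ 3 = (c.L ^ n * c.ξ) ^ 2 * (c.L ^ n * c.ξ) := by ring
      _ ≤ (c.L ^ n * c.ξ) ^ 2 * 1 := mul_le_mul_of_nonneg_left hr1 hr2.le
      _ = (c.L ^ n * c.ξ) ^ 2 := mul_one _
  rw [norm_pairOf_Jn_eq π hξ hL0 Un n V b]
  calc (c.L ^ n * c.ξ) ^ 3 * ‖current π c.ξ (Un n V) b‖
      < (c.L ^ n * c.ξ) ^ 3 * α₀ := mul_lt_mul_of_pos_left hJb (by positivity)
    _ ≤ (c.L ^ n * c.ξ) ^ 2 * α₀ := mul_le_mul_of_nonneg_right hr32 hα₀.le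
    _ = α₀ * (c.L ^ n * c.ξ) ^ 2 := mul_comm _ _

end Bounds

/-! ## §3. (iv) from (iii) for the assembled pair, with (3.38) as the printed configuration identity -/

section Eq338

variable {P : Params} {i : ℕ} {𝔸 : Type*} [NormedRing 𝔸] [NormedAlgebra ℂ 𝔸]

/-- (3.38) as an identity of configurations, `U_n(X, M˙(V)) = V^{w_n}` (`w_n = u_j(ū_j)⁻¹`), gives p07's plaquette-level instance
`∂(U_n(X, M˙(V)))(p) = ∂(V^{w_n})(p)` for the assembled pair. [cite: Balaban1987RG1, (3.38) p.278 with (1.15) p.262] -/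
theorem plaq_pairOf_eq_of_eq338 (π : 𝔸 →ₗ[ℂ] 𝔸) (c : StepConsts) {Un : ℕ → (PBond P i → 𝔸ˣ) → PBond P i → 𝔸ˣ}
    (X₂ : Region P i) {V : PBond P i → 𝔸ˣ} {w : ℕ → Site P i → 𝔸ˣ}
    (h338 : ∀ n, 1 ≤ n → n ≤ c.j → Un n V = gaugeU (w n) V) :
    ∀ n, 1 ≤ n → n ≤ c.j → ∀ p ∈ X₂.plaqs, plaq ((pairOf π c Un).Un n V) p = plaq (gaugeU (w n) V) p := by
  intro n hn hnj p _
  rw [pairOf_Un, h338 n hn hnj]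

/-- (3.38) as an identity of configurations gives, BY THE DEFINITION of the J-half, p07's bond-level instance «J_n(M˙(V))(b) =
((1.8) at L⁻ⁿ)(V^{w_n})(b)» (his hypothesis `hJn`) for the assembled pair. [cite: Balaban1987RG1, (3.38) p.278 with (1.15) p.262] -/
theorem pairOf_Jn_eq_of_eq338 (π : 𝔸 →ₗ[ℂ] 𝔸) (c : StepConsts) {Un : ℕ → (PBond P i → 𝔸ˣ) → PBond P i → 𝔸ˣ}
    (X₂ : Region P i) {V : PBond P i → 𝔸ˣ} {w : ℕ → Site P i → 𝔸ˣ}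
    (h338 : ∀ n, 1 ≤ n → n ≤ c.j → Un n V = gaugeU (w n) V) :
    ∀ n, 1 ≤ n → n ≤ c.j → ∀ b ∈ X₂.bonds,
      (pairOf π c Un).Jn n V b = current π (c.L ^ n)⁻¹ (gaugeU (w n) V) b := by
  intro n hn hnj b _
  rw [pairOf_Jn_apply, h338 n hn hnj]

/-- **«the condition (iv) is a consequence of the condition (iii), with a bit better constant» FOR THE ASSEMBLED PAIR.**  Let the
U-half satisfy (3.38) p. 278 as the printed configuration identity `U_n(X, M˙(V)) = V^{w_n}`, `n = 1, …, j` (`w_n = u_j(ū_j)⁻¹`, each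
value of rotation cost `‖w_n(x)‖‖w_n(x)⁻¹‖ ≤ E`, `π` commuting with their `Ad`); if `V` obeys the (iii)-type bounds
`|∂V − 1| < α₀′ξ²`, `|J_ξ(V)| < γ₀′` on `X̃⁻²` with `Eα₀′ ≤ α₀`, `Eγ₀′ ≤ α₀`, then the pair `(U_n(M˙(V)), J_n(M˙(V)))` of (1.15) satisfies
(1.16) with `α₀`.  (= p07's `B12Eq338CondIV.condIV_of_eq338` with its hypothesis `hJn` discharged by the definition of the J-half.)
[cite: Balaban1987RG1, (3.38) p.278 with (1.15)-(1.16) p.262] -/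
theorem condIV_pairOf_of_eq338 (π : 𝔸 →ₗ[ℂ] 𝔸) {c : StepConsts} {Un : ℕ → (PBond P i → 𝔸ˣ) → PBond P i → 𝔸ˣ}
    {X₂ : Region P i} {α₀ α₀' γ₀' E : ℝ} {V : PBond P i → 𝔸ˣ} {w : ℕ → Site P i → 𝔸ˣ}
    (hξ : 0 < c.ξ) (hL : 1 ≤ c.L) (hLξ : c.L ^ c.j * c.ξ = 1)
    (h338 : ∀ n, 1 ≤ n → n ≤ c.j → Un n V = gaugeU (w n) V)
    (hπ : ∀ n x X, π (R (w n x) X) = R (w n x) (π X))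
    (hw : ∀ n x, ‖(w n x : 𝔸)‖ * ‖(↑(w n x)⁻¹ : 𝔸)‖ ≤ E) (hE : 0 < E)
    (hV : ∀ p ∈ X₂.plaqs, ‖((plaq V p : 𝔸ˣ) : 𝔸) - 1‖ < α₀' * c.ξ ^ 2) (hEα : E * α₀' ≤ α₀)
    (hJ : ∀ b ∈ X₂.bonds, ‖current π c.ξ V b‖ < γ₀') (hEγ : E * γ₀' ≤ α₀) :
    CondIV (pairOf π c Un) X₂ c α₀ V :=
  condIV_of_eq338 π hξ hL hLξ (plaq_pairOf_eq_of_eq338 π c X₂ h338) (pairOf_Jn_eq_of_eq338 π c X₂ h338)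
    hπ hw hE hV hEα hJ hEγ

/-- **«and the same bounds hold for U instead of 𝐔» for the factor `U = 1`, FOR THE ASSEMBLED PAIR**: with (3.38) at `τ = 0`,
`B′ = 0` as the configuration identity `U_n(M˙(1)) = 1^{w_n}` (a pure gauge), the pair `(U_n(M˙(1)), J_n(M˙(1)))` satisfies (1.16)
for every `α₀ > 0` (plaquette variables `1`, current `0`).  (= p07's `condIV_one_of_eq338`, `hJn` discharged.)
[cite: Balaban1987RG1, (3.38) p.278 with (1.15)-(1.16) p.262] -/
theorem condIV_one_pairOf_of_eq338 (π : 𝔸 →ₗ[ℂ] 𝔸) {c : StepConsts} {Un : ℕ → (PBond P i → 𝔸ˣ) → PBond P i → 𝔸ˣ}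
    {X₂ : Region P i} {α₀ : ℝ} {w : ℕ → Site P i → 𝔸ˣ} (hα₀ : 0 < α₀) (hξ : 0 < c.ξ) (hL : 1 ≤ c.L)
    (h338 : ∀ n, 1 ≤ n → n ≤ c.j → Un n (1 : PBond P i → 𝔸ˣ) = gaugeU (w n) (1 : PBond P i → 𝔸ˣ))
    (hπ : ∀ n x X, π (R (w n x) X) = R (w n x) (π X)) :
    CondIV (pairOf π c Un) X₂ c α₀ (1 : PBond P i → 𝔸ˣ) :=
  condIV_one_of_eq338 π hα₀ hξ hL (plaq_pairOf_eq_of_eq338 π c X₂ h338) (pairOf_Jn_eq_of_eq338 π c X₂ h338) hπ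

end Eq338

/-! ## §4. (i)–(iv) for the Lemma-4 pair `(exp iξ𝐊, 𝐉)` on a frame whose (iv)-datum obeys the (1.15) definition sentence -/

section Lemma4

variable {P : Params} {i : ℕ} {𝔸 : Type*} [NormedRing 𝔸] [NormedAlgebra ℂ 𝔸] [CompleteSpace 𝔸] (𝓜 : Model 𝔸)

omit [CompleteSpace 𝔸] in
/-- **A frame «satisfies the (1.15) definition sentence»** when the J-half of its (iv)-datum is (1.8) at the parameter `L⁻ⁿ` applied to
its U-half; then `F.bg = pairOf π c F.bg.Un` (`eq_pairOf_of_Jn`). [cite: Balaban1987RG1, (1.15) p.262] -/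
theorem bg_eq_pairOf_of_Jdef (π : 𝔸 →ₗ[ℂ] 𝔸) (c : StepConsts) (F : Frame P i 𝔸)
    (hJdef : ∀ n V, F.bg.Jn n V = current π (c.L ^ n)⁻¹ (F.bg.Un n V)) : F.bg = pairOf π c F.bg.Un :=
  eq_pairOf_of_Jn π c F.bg hJdef

/-- **(i)–(iv) for the pair `(exp iξ𝐊, 𝐉)` with (iv) derived from (3.38) AS A CONFIGURATION IDENTITY** — p07's
`B12Eq338CondIV.satisfies_expI_of_eq338` on a frame `F` whose (iv)-datum obeys the (1.15) definition sentence (`hJdef`): of his four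
(3.38)-hypotheses `h338`, `hJn`, `h338₁`, `hJn₁` only the two printed identities remain, at configuration level —
`U_n(X, M˙(exp iξ𝐊)) = (exp iξ𝐊)^{w_n}` and `U_n(X, M˙(1)) = 1^{w₁,n}`, `n = 1, …, j` ((3.38) p. 278 for `V` and, at `τ = 0`, `B′ = 0`,
for `U = 1`); the bond-level `J`-instances are consequences of the definition.  All other hypotheses verbatim as in p07's theorem.
[cite: Balaban1987RG1, (3.36) p.277 with (3.38) p.278 and (1.15) p.262] -/
theorem satisfies_expI_of_eq338_of_Jdef {F : Frame P i 𝔸} {cs : StepConsts} (hξ : 0 < cs.ξ) (hcB : 0 < cs.cB)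
    (hL : 1 ≤ cs.L) (hLξ : cs.L ^ cs.j * cs.ξ = 1) {α₀ α₁ γ₀ α₀' γ₀' E : ℝ}
    (hα₀ : 0 < α₀) (heGc : ∀ A ∈ 𝓜.gc, expI cs.ξ A ∈ 𝓜.Gc) (π : 𝔸 →ₗ[ℂ] 𝔸)
    (hJdef : ∀ n V, F.bg.Jn n V = current π (cs.L ^ n)⁻¹ (F.bg.Un n V))
    {K J : PBond P i → 𝔸}
    (hKgc : ∀ b ∈ F.X.bonds, K b ∈ 𝓜.gc) (hJgc : ∀ b ∈ F.X.bonds, J b ∈ 𝓜.gc) (hK0 : ∀ b ∈ F.X.bonds, ‖K b‖ < α₁)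
    (hK1 : ∀ q ∈ F.X.dpairs, ‖grad cs.ξ q.2.1 (fun y => K ⟨y, q.2.2⟩) q.1‖ < α₁)
    (hplaq : ∀ p ∈ F.X.plaqs, ‖((plaq (fun b => expI cs.ξ (K b)) p : 𝔸ˣ) : 𝔸) - 1‖ < α₀ * cs.ξ ^ 2)
    (hJ : ∀ b ∈ F.X.bonds, ‖J b‖ < γ₀)
    {w w₁ : ℕ → Site P i → 𝔸ˣ}
    (h338 : ∀ n, 1 ≤ n → n ≤ cs.j → F.bg.Un n (fun b => expI cs.ξ (K b)) = gaugeU (w n) (fun b => expI cs.ξ (K b)))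
    (hπ : ∀ n x X, π (R (w n x) X) = R (w n x) (π X))
    (hw : ∀ n x, ‖(w n x : 𝔸)‖ * ‖(↑(w n x)⁻¹ : 𝔸)‖ ≤ E) (hE : 0 < E)
    (hV : ∀ p ∈ F.X₂.plaqs, ‖((plaq (fun b => expI cs.ξ (K b)) p : 𝔸ˣ) : 𝔸) - 1‖ < α₀' * cs.ξ ^ 2) (hEα : E * α₀' ≤ α₀)
    (hJ' : ∀ b ∈ F.X₂.bonds, ‖current π cs.ξ (fun b => expI cs.ξ (K b)) b‖ < γ₀') (hEγ : E * γ₀' ≤ α₀)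
    (h338₁ : ∀ n, 1 ≤ n → n ≤ cs.j → F.bg.Un n (1 : PBond P i → 𝔸ˣ) = gaugeU (w₁ n) (1 : PBond P i → 𝔸ˣ))
    (hπ₁ : ∀ n x X, π (R (w₁ n x) X) = R (w₁ n x) (π X)) :
    Satisfies 𝓜 F cs α₀ α₁ γ₀ ⟨fun b => expI cs.ξ (K b), J⟩ :=
  satisfies_expI_of_eq338 𝓜 hξ hcB hL hLξ hα₀ heGc π hKgc hJgc hK0 hK1 hplaq hJ
    (fun n hn hnj p _ => by rw [h338 n hn hnj])
    (fun n hn hnj b _ => by rw [hJdef, h338 n hn hnj])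
    hπ hw hE hV hEα hJ' hEγ
    (fun n hn hnj p _ => by rw [h338₁ n hn hnj])
    (fun n hn hnj b _ => by rw [hJdef, h338₁ n hn hnj])
    hπ₁

/-- The same on the frame ASSEMBLED from a U-half, `F = ⟨X, cubes, X̃⁻², pairOf π c Un⟩`: `hJdef` holds by `rfl`.
[cite: Balaban1987RG1, (3.36) p.277 with (3.38) p.278 and (1.15) p.262] -/
theorem satisfies_expI_pairOf_of_eq338 {X : Region P i} {cubes : Set (Region P i)} {X₂ : Region P i}
    {Un : ℕ → (PBond P i → 𝔸ˣ) → PBond P i → 𝔸ˣ} {cs : StepConsts} (hξ : 0 < cs.ξ) (hcB : 0 < cs.cB)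
    (hL : 1 ≤ cs.L) (hLξ : cs.L ^ cs.j * cs.ξ = 1) {α₀ α₁ γ₀ α₀' γ₀' E : ℝ}
    (hα₀ : 0 < α₀) (heGc : ∀ A ∈ 𝓜.gc, expI cs.ξ A ∈ 𝓜.Gc) (π : 𝔸 →ₗ[ℂ] 𝔸)
    {K J : PBond P i → 𝔸}
    (hKgc : ∀ b ∈ X.bonds, K b ∈ 𝓜.gc) (hJgc : ∀ b ∈ X.bonds, J b ∈ 𝓜.gc) (hK0 : ∀ b ∈ X.bonds, ‖K b‖ < α₁)
    (hK1 : ∀ q ∈ X.dpairs, ‖grad cs.ξ q.2.1 (fun y => K ⟨y, q.2.2⟩) q.1‖ < α₁)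
    (hplaq : ∀ p ∈ X.plaqs, ‖((plaq (fun b => expI cs.ξ (K b)) p : 𝔸ˣ) : 𝔸) - 1‖ < α₀ * cs.ξ ^ 2)
    (hJ : ∀ b ∈ X.bonds, ‖J b‖ < γ₀)
    {w w₁ : ℕ → Site P i → 𝔸ˣ}
    (h338 : ∀ n, 1 ≤ n → n ≤ cs.j → Un n (fun b => expI cs.ξ (K b)) = gaugeU (w n) (fun b => expI cs.ξ (K b)))
    (hπ : ∀ n x X, π (R (w n x) X) = R (w n x) (π X))
    (hw : ∀ n x, ‖(w n x : 𝔸)‖ * ‖(↑(w n x)⁻¹ : 𝔸)‖ ≤ E) (hE : 0 < E)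
    (hV : ∀ p ∈ X₂.plaqs, ‖((plaq (fun b => expI cs.ξ (K b)) p : 𝔸ˣ) : 𝔸) - 1‖ < α₀' * cs.ξ ^ 2) (hEα : E * α₀' ≤ α₀)
    (hJ' : ∀ b ∈ X₂.bonds, ‖current π cs.ξ (fun b => expI cs.ξ (K b)) b‖ < γ₀') (hEγ : E * γ₀' ≤ α₀)
    (h338₁ : ∀ n, 1 ≤ n → n ≤ cs.j → Un n (1 : PBond P i → 𝔸ˣ) = gaugeU (w₁ n) (1 : PBond P i → 𝔸ˣ))
    (hπ₁ : ∀ n x X, π (R (w₁ n x) X) = R (w₁ n x) (π X)) :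
    Satisfies 𝓜 (⟨X, cubes, X₂, pairOf π cs Un⟩ : Frame P i 𝔸) cs α₀ α₁ γ₀ ⟨fun b => expI cs.ξ (K b), J⟩ :=
  satisfies_expI_of_eq338_of_Jdef 𝓜 hξ hcB hL hLξ hα₀ heGc π (fun _ _ => rfl) hKgc hJgc hK0 hK1 hplaq hJ h338 hπ hw hE
    hV hEα hJ' hEγ h338₁ hπ₁

end Lemma4

/-! ## §5. (v1.2) THE U-HALF ASSEMBLED, and (1.17) DERIVED AT PRINT'S SEAM for the assembled datum: `𝐔 ↦ U_n(M˙(𝐔))` = the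
continuation of B11's minimiser `U_n` ([15] Prop. 9, first clause; DATA `extU`, pinned on the `G`-valued fields to `Background.U n`)
composed with `M˙ = M^n = Ū^n` ((1.5) [14] ∕ (0.11); DATA `extM`, pinned on the `G`-valued fields to B8's `Averaging.iter av n`);
(1.17) for THIS datum from two inputs in their rows' shapes — (E1) the [15] regularity of the functions `U_n(·)` ALONE, `ε₁` free,
and (E2) the averaging bound «|∂Ū^p − 1| < 2α₀′(L^pξ)²» of [12] Prop. 2 — plus the thresholds «for α₀′ sufficiently small» -/

section UHalf

/-- **The U-half of the (iv)-datum (1.15), ASSEMBLED.**  Print (p. 262): *«we construct the functions U_n(V) in the axial gauges, for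
regular Gᶜ-valued configurations V. We consider the pair (U_n(M˙(𝐔)), J_n(M˙(𝐔))) … where M˙(𝐔, b) = M^p(𝐔, b) = Ū^p(b) for b ∈ Λ_p
(see (1.5) [14])»*.  The structure EXTENDS the tree's `Setup.Background P G av` (B11: the minimisers `V ↦ U_n(V)` of [15] Thm 1 as
data with their defining property `IsBackground`) by
* `ι : G ↪ 𝔸ˣ` (injective) — the value clause (1.10) («U has values in the group G», «𝐔 … has values in Gᶜ»);
* `extU n : (𝔸ˣ-valued fields on T⁽ⁿ⁾) → (fields on T⁽⁰⁾)` — print's intermediate object, the CONTINUATION OF THE MINIMISER: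
  [15] Prop. 9 p. 309, first clause, *«The minimal configuration U_k(V) = U_k(V′V₀) in the axial gauge has an extension to an
  analytic function of Gᶜ-valued small configurations V′»* — DATA, PINNED on the `G`-valued fields: `extU_real : extU n (ι ∘ W) =
  ι ∘ U n W` (there it IS B11's minimiser, letter for letter);
* `extM n : (𝔸ˣ-valued fields on T⁽⁰⁾) → (fields on T⁽ⁿ⁾)` — `M˙ = M^n = Ū^n` on `𝔸ˣ`-valued fields ((1.5) [14]; (0.11): print
  applies `M˙` to the Gᶜ-valued `𝐔` without comment) — DATA, PINNED on the `G`-valued fields: `extM_real : extM n (ι ∘ 𝐔) =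
  ι ∘ Averaging.iter av n 𝐔` (B8's n-fold average BY NAME).  LOCATED MODELLING NOTE: the tree's one-step averaging
  `Setup.Averaging P j G` is a `[GaugeGroup G]`-structure (covariance + locality axioms) and does not instantiate at `𝔸ˣ`, so the
  Gᶜ-average is a pinned letter exactly like `extU`.
NO existence ∕ analyticity field: those are [15]'s theorems (rows B11.Prop9, B11.Thm1), by reference, used as named hypotheses only
at the rows where print uses them — the structure asserts nothing beyond `Background` (`exists_of_background`).
[cite: Balaban1987RG1, (1.15) p.262] -/
structure UHalf (P : Params) (G : Type*) [GaugeGroup G] (𝔸 : Type*) [Monoid 𝔸] (av : ∀ j, Averaging P j G)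
    extends Background P G av where
  /-- `G ↪ Gᶜ ⊆ 𝔸ˣ` ((1.10)) -/
  ι : G →* 𝔸ˣ
  /-- `ι` is an inclusion -/
  ι_injective : Function.Injective ι
  /-- `W ↦ U_n(W)` on `𝔸ˣ`-valued fields of `T⁽ⁿ⁾`: the continuation of the minimiser ([15] Prop. 9, first clause), DATA -/
  extU : (n : ℕ) → (PBond P n → 𝔸ˣ) → PBond P 0 → 𝔸ˣ
  /-- on `G`-valued fields `extU n` IS B11's minimiser `Background.U n` -/
  extU_real : ∀ (n : ℕ) (W : GaugeField P n G), extU n (fun b => ι (W b)) = fun b => ι (U n W b)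
  /-- `𝐔 ↦ M˙(𝐔) = M^n(𝐔) = Ū^n` on `𝔸ˣ`-valued fields of `T⁽⁰⁾` ((1.5) [14], (0.11)), DATA -/
  extM : (n : ℕ) → (PBond P 0 → 𝔸ˣ) → PBond P n → 𝔸ˣ
  /-- on `G`-valued fields `extM n` IS B8's n-fold average `Averaging.iter av n` -/
  extM_real : ∀ (n : ℕ) (Ug : GaugeField P 0 G), extM n (fun b => ι (Ug b)) = fun b => ι (Averaging.iter av n Ug b)

namespace UHalf

variable {P : Params} {G : Type*} [GaugeGroup G]

section Monoid

variable {𝔸 : Type*} [Monoid 𝔸] {av : ∀ j, Averaging P j G}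

/-- **NON-VACUITY ∕ CONSERVATIVITY** (B12-Q22 (β): data yes, axiom no): every B11 background-field assignment (`Setup.Background`)
together with an injective `ι : G →* 𝔸ˣ` extends to a `UHalf` — continue `ι ∘ U_n` and `ι ∘ M^n` off the `G`-valued fields by junk
(the constant field `1`); so the structure asserts nothing beyond `Background`, in particular no existence or analyticity of the
[15] continuation. [cite: Balaban1987RG1, (1.15) p.262] -/
theorem exists_of_background (bg : Background P G av) (ι : G →* 𝔸ˣ) (hι : Function.Injective ι) :
    ∃ D : UHalf P G 𝔸 av, D.toBackground = bg ∧ D.ι = ι := by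
  classical
  let extU : (n : ℕ) → (PBond P n → 𝔸ˣ) → PBond P 0 → 𝔸ˣ := fun n W =>
    if h : ∃ W₀ : GaugeField P n G, W = (fun b => ι (W₀ b)) then (fun b => ι (bg.U n h.choose b)) else fun _ => 1
  have hextU : ∀ (n : ℕ) (W₀ : GaugeField P n G), extU n (fun b => ι (W₀ b)) = fun b => ι (bg.U n W₀ b) := by
    intro n W₀
    have h : ∃ W' : GaugeField P n G, (fun b => ι (W₀ b)) = (fun b => ι (W' b)) := ⟨W₀, rfl⟩
    have hc : h.choose = W₀ := by
      funext b
      exact (hι (congrFun h.choose_spec b)).symm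
    show (if h : ∃ W' : GaugeField P n G, (fun b => ι (W₀ b)) = (fun b => ι (W' b)) then
      (fun b => ι (bg.U n h.choose b)) else fun _ => 1) = _
    rw [dif_pos h, hc]
  let extM : (n : ℕ) → (PBond P 0 → 𝔸ˣ) → PBond P n → 𝔸ˣ := fun n V =>
    if h : ∃ Ug : GaugeField P 0 G, V = (fun b => ι (Ug b)) then (fun b => ι (Averaging.iter av n h.choose b)) else fun _ => 1
  have hextM : ∀ (n : ℕ) (Ug : GaugeField P 0 G),
      extM n (fun b => ι (Ug b)) = fun b => ι (Averaging.iter av n Ug b) := by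
    intro n Ug
    have h : ∃ Ug' : GaugeField P 0 G, (fun b => ι (Ug b)) = (fun b => ι (Ug' b)) := ⟨Ug, rfl⟩
    have hc : h.choose = Ug := by
      funext b
      exact (hι (congrFun h.choose_spec b)).symm
    show (if h : ∃ Ug' : GaugeField P 0 G, (fun b => ι (Ug b)) = (fun b => ι (Ug' b)) then
      (fun b => ι (Averaging.iter av n h.choose b)) else fun _ => 1) = _
    rw [dif_pos h, hc]
  exact ⟨⟨bg, ι, hι, extU, hextU, extM, hextM⟩, rfl, rfl⟩

variable (D : UHalf P G 𝔸 av)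

/-- `extU n` on a `G`-valued field of `T⁽ⁿ⁾`, at a bond: `U_n(W)(b)` of B11. [cite: Balaban1987RG1, (1.15) p.262] -/
theorem extU_apply_real (n : ℕ) (W : GaugeField P n G) (b : PBond P 0) :
    D.extU n (fun b => D.ι (W b)) b = D.ι (D.U n W b) := by
  rw [D.extU_real n W]

/-- `extM n` on a `G`-valued field of `T⁽⁰⁾`, at a bond: `Ū^n(b)` of B8. [cite: Balaban1987RG1, (1.15) p.262] -/
theorem extM_apply_real (n : ℕ) (Ug : GaugeField P 0 G) (b : PBond P n) :
    D.extM n (fun b => D.ι (Ug b)) b = D.ι (Averaging.iter av n Ug b) := by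
  rw [D.extM_real n Ug]

/-- **Print's composite on the `G`-valued fields**: `U_n(M˙(𝐔)) = U_n(M^n(𝐔))` — B11's minimiser of B8's n-fold average, read in
`Gᶜ ⊆ 𝔸ˣ`; a THEOREM of the two pinnings. [cite: Balaban1987RG1, (1.15) p.262] -/
theorem extU_extM_real (n : ℕ) (Ug : GaugeField P 0 G) :
    D.extU n (D.extM n (fun b => D.ι (Ug b))) = fun b => D.ι (D.U n (Averaging.iter av n Ug) b) := by
  rw [D.extM_real, D.extU_real]

/-- On `G`-valued fields in B11's domain `extU n` is a MINIMISER of the constrained variational problem ([15] Thm 1 as carried by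
`IsBackground`): `extU n (ι ∘ W) = ι ∘ U₀` with `M^n(U₀) = W`, `U₀` regular and minimising the Wilson action on the constraint surface.
[cite: Balaban1987RG1, (1.15) p.262] -/
theorem extU_real_isBackground (n : ℕ) {W : GaugeField P n G} (hW : W ∈ D.dom n) :
    ∃ U₀ : GaugeField P 0 G, D.extU n (fun b => D.ι (W b)) = (fun b => D.ι (U₀ b)) ∧ IsBackground av D.reg n W U₀ :=
  ⟨D.U n W, D.extU_real n W, D.isBackground n W hW⟩

end Monoid

section Ring

variable {𝔸 : Type*} [Ring 𝔸] [Algebra ℂ 𝔸] {av : ∀ j, Averaging P j G} (D : UHalf P G 𝔸 av)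

/-- **THE ASSEMBLED (iv)-DATUM (1.15) OF PRINT'S INSTANCE**: U-half `𝐔 ↦ U_n(M^n(𝐔))` = `extU n ∘ extM n`, J-half = «the formula
(1.8) with U_n(M˙(𝐔)) instead of U_j, L⁻ⁿ instead of ξ» (`pairOf`, §1). [cite: Balaban1987RG1, (1.15) p.262] -/
def bgOf (π : 𝔸 →ₗ[ℂ] 𝔸) (c : StepConsts) : BackgroundFns P 0 𝔸 :=
  pairOf π c fun n V => D.extU n (D.extM n V)

/-- The U-half of the assembled datum is the composite `U_n ∘ M^n`. [cite: Balaban1987RG1, (1.15) p.262] -/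
@[simp] theorem bgOf_Un (π : 𝔸 →ₗ[ℂ] 𝔸) (c : StepConsts) (n : ℕ) (V : PBond P 0 → 𝔸ˣ) :
    (D.bgOf π c).Un n V = D.extU n (D.extM n V) := rfl

/-- The J-half of the assembled datum is (1.8) at `L⁻ⁿ` of the composite. [cite: Balaban1987RG1, (1.15) p.262] -/
theorem bgOf_Jn (π : 𝔸 →ₗ[ℂ] 𝔸) (c : StepConsts) (n : ℕ) (V : PBond P 0 → 𝔸ˣ) :
    (D.bgOf π c).Jn n V = current π (c.L ^ n)⁻¹ (D.extU n (D.extM n V)) := rfl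

/-- The assembled datum IS `pairOf` of its U-half (§1's forced form). [cite: Balaban1987RG1, (1.15) p.262] -/
theorem bgOf_eq_pairOf (π : 𝔸 →ₗ[ℂ] 𝔸) (c : StepConsts) : D.bgOf π c = pairOf π c (D.bgOf π c).Un := rfl

/-- **THE IDENTIFICATION (U-half)** — a THEOREM of the pinnings (B12-Q22 (β)): on a `G`-valued field the first function of (1.15)
IS `U_n(M^n(𝐔))`, B11's minimiser (`Background.U n`) of B8's n-fold average (`Averaging.iter av n`), read in `Gᶜ ⊆ 𝔸ˣ`.
[cite: Balaban1987RG1, (1.15) p.262] -/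
theorem bgOf_Un_real (π : 𝔸 →ₗ[ℂ] 𝔸) (c : StepConsts) (n : ℕ) (Ug : GaugeField P 0 G) :
    (D.bgOf π c).Un n (fun b => D.ι (Ug b)) = fun b => D.ι (D.U n (Averaging.iter av n Ug) b) :=
  D.extU_extM_real n Ug

/-- **THE IDENTIFICATION (J-half)**: on a `G`-valued field the second function of (1.15) IS (1.8) at `L⁻ⁿ` of `U_n(M^n(𝐔))`.
[cite: Balaban1987RG1, (1.15) p.262] -/
theorem bgOf_Jn_real (π : 𝔸 →ₗ[ℂ] 𝔸) (c : StepConsts) (n : ℕ) (Ug : GaugeField P 0 G) :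
    (D.bgOf π c).Jn n (fun b => D.ι (Ug b)) = current π (c.L ^ n)⁻¹ (fun b => D.ι (D.U n (Averaging.iter av n Ug) b)) := by
  rw [bgOf_Jn, D.extU_extM_real]

/-- On B11's domain the U-half of the assembled datum at a `G`-valued field is (`ι` of) a constrained minimiser (`IsBackground`).
[cite: Balaban1987RG1, (1.15) p.262] -/
theorem bgOf_Un_real_isBackground (π : 𝔸 →ₗ[ℂ] 𝔸) (c : StepConsts) (n : ℕ) {Ug : GaugeField P 0 G}
    (hUg : Averaging.iter av n Ug ∈ D.dom n) :
    ∃ U₀ : GaugeField P 0 G, (D.bgOf π c).Un n (fun b => D.ι (Ug b)) = (fun b => D.ι (U₀ b)) ∧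
      IsBackground av D.reg n (Averaging.iter av n Ug) U₀ :=
  ⟨D.U n (Averaging.iter av n Ug), D.bgOf_Un_real π c n Ug, D.isBackground n _ hUg⟩

/-- The frame of (1.11)–(1.16) for a localization domain `X` with print's assembled (iv)-datum. [cite: Balaban1987RG1, (1.15) p.262] -/
def frame (π : 𝔸 →ₗ[ℂ] 𝔸) (c : StepConsts) (X : Region P 0) (cubes : Set (Region P 0)) (X₂ : Region P 0) : Frame P 0 𝔸 :=
  ⟨X, cubes, X₂, D.bgOf π c⟩

/-- The localization domain of the assembled frame. [cite: Balaban1987RG1, (1.15) p.262] -/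
@[simp] theorem frame_X (π : 𝔸 →ₗ[ℂ] 𝔸) (c : StepConsts) (X : Region P 0) (cubes : Set (Region P 0)) (X₂ : Region P 0) :
    (D.frame π c X cubes X₂).X = X := rfl

/-- The cubes `□ ⊂ X` of the assembled frame. [cite: Balaban1987RG1, (1.15) p.262] -/
@[simp] theorem frame_cubes (π : 𝔸 →ₗ[ℂ] 𝔸) (c : StepConsts) (X : Region P 0) (cubes : Set (Region P 0)) (X₂ : Region P 0) :
    (D.frame π c X cubes X₂).cubes = cubes := rfl

/-- The region `X̃⁻²` of the assembled frame. [cite: Balaban1987RG1, (1.15) p.262] -/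
@[simp] theorem frame_X₂ (π : 𝔸 →ₗ[ℂ] 𝔸) (c : StepConsts) (X : Region P 0) (cubes : Set (Region P 0)) (X₂ : Region P 0) :
    (D.frame π c X cubes X₂).X₂ = X₂ := rfl

/-- The (iv)-datum of the assembled frame is `bgOf`. [cite: Balaban1987RG1, (1.15) p.262] -/
@[simp] theorem frame_bg (π : 𝔸 →ₗ[ℂ] 𝔸) (c : StepConsts) (X : Region P 0) (cubes : Set (Region P 0)) (X₂ : Region P 0) :
    (D.frame π c X cubes X₂).bg = D.bgOf π c := rfl

/-- The assembled frame «satisfies the (1.15) definition sentence» of §4 (`hJdef` by `rfl`). [cite: Balaban1987RG1, (1.15) p.262] -/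
theorem frame_Jdef (π : 𝔸 →ₗ[ℂ] 𝔸) (c : StepConsts) (X : Region P 0) (cubes : Set (Region P 0)) (X₂ : Region P 0)
    (n : ℕ) (V : PBond P 0 → 𝔸ˣ) :
    (D.frame π c X cubes X₂).bg.Jn n V = current π (c.L ^ n)⁻¹ ((D.frame π c X cubes X₂).bg.Un n V) := rfl

end Ring

section Eq117

variable {𝔸 : Type*} [NormedRing 𝔸] [NormedAlgebra ℂ 𝔸] {av : ∀ j, Averaging P j G} (D : UHalf P G 𝔸 av)

/-- **(1.17) DERIVED AT PRINT'S SEAM for the assembled datum** (B12-Q22 (α)).  Print (p. 263): *«Now consider the functions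
U_n(M˙(𝐔)). We have M˙(𝐔) = Ū^p on Λ_p, |∂Ū^p − 1| < 2α₀′(L^pξ)². From Proposition 9 [15] we obtain |∂U_n(M˙(𝐔)) − 1| <
B₃2α₀′L^{−2n}(Lⁿξ)² = 2B₃α₀′ξ², |J_n(M˙(𝐔))| < B₃2α₀′(Lⁿξ)² on X̃⁻². (1.17)»*  The two inputs, in their rows' shapes:
* **(E1) `hP9`** — the [15] regularity of the [15]-FUNCTIONS `U_n(·)` ALONE, `ε₁` FREE: for every `0 < ε₁ ≤ a₁` ([15] Thm 1 p. 279: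
  «V satisfying (7) with ε₁ ≤ a₁»; (7) p. 278: «|(∂V)(p′) − 1| < ε₁ for p′ ⊂ 𝔅») and every `𝔸ˣ`-valued configuration `W` of `T⁽ⁿ⁾` small
  on `Λ_n` (`|∂W(p′) − 1| < ε₁(Lⁿξ)²`, the level-`n` plaquettes in their own units), the function `U_n(W) = extU n W` obeys
  `|∂U_n(W) − 1| < B₃ε₁L⁻²ⁿ(Lⁿξ)²` on `X̃⁻²` — [15] Thm 1 (9)–(10) p. 279, Sect. F p. 300 («To prove the regularity properties (9), (10)…»),
  `ε₀ = B₃ε₁`, kept by the continuation: Prop. 9 p. 309 «It satisfies the conditions (19)–(21)» — AND `|J_n(W)| < B₃ε₁(Lⁿξ)²` on `X̃⁻²`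
  for `J_n(W) := ((1.8) at L⁻ⁿ)(U_n(W))` (print's definition (1.15), `pairOf`).  CHOICE OF SHAPE (lead: «say which»): the J-line is
  carried in print's own (1.17) shape with `ε₁` free — print's words are «From Proposition 9 [15] we obtain» BOTH lines; the passage
  from [15] (10) ∕ (190) to the (1.8)-current is inside that «we obtain» and is NOT proved here.  No `M˙` inside (E1).  Rows
  B11.Prop9 · B11.Thm1 ∕ B11.Eq169, BY REFERENCE;
* **(E2) `havg`** — «M˙(𝐔) = Ū^p on Λ_p» is `extM` by definition ((1.5) [14], row B8.Eq1.5), and «|∂Ū^p − 1| < 2α₀′(L^pξ)²» from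
  `|∂𝐔 − 1| < α₀′ξ²` on `X` is [12] Prop. 2 (54) p. 26 in its printed shape, `α₀` FREE: «If U satisfies (52) [|U(∂p) − 1| < α₀η²] with
  α₀ ≤ c₂ … then |Ū^k(∂p) − 1| < α₀ + 2C₀α₀² < 2α₀, p ⊂ Ω^{(k)}» (there `L^kη = 1`; here the level-`n` unit is `Lⁿξ`) — row B7.Prop2
  (`B7.Prop2Printed`; proved on the `ℤᵈ` carrier as `B7Prop2Explicit.prop2_explicit_lt_two`), BY REFERENCE on this carrier (the
  abstract `Setup.Averaging` has no formula, so no estimate is provable for `Averaging.iter` itself);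
* thresholds «for α₀′ sufficiently small»: `0 < α₀′`, `α₀′ ≤ c₂` (for (E2)), `2α₀′ ≤ a₁` (for (E1) at `ε₁ = 2α₀′`).
CONCLUSION: (1.17) for the datum `bgOf` — p07's hypothesis shape `h117` of `B12Eq117Concrete`, now a theorem — for EVERY configuration
`V` with `|∂V − 1| < α₀′ξ²` on `X` (so for `𝐔` by (iii) and for the `G`-valued factor `U` by (1.11)).  One-level carrier: (E1) and (E2)
meet on the top layer `Λ_n ⊂ T⁽ⁿ⁾` (the level sets `Λ : (n : ℕ) → Set (Plaq P n)` are geometry data, as `Region`).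
[cite: Balaban1987RG1, (1.17) p.263] -/
theorem eq117_of_inputs (π : 𝔸 →ₗ[ℂ] 𝔸) (c : StepConsts) (X X₂ : Region P 0) (Λ : (n : ℕ) → Set (Plaq P n))
    {B₃ a₁ c₂ α₀' : ℝ}
    (hP9 : ∀ ε₁ : ℝ, 0 < ε₁ → ε₁ ≤ a₁ → ∀ n, 1 ≤ n → n ≤ c.j → ∀ W : PBond P n → 𝔸ˣ,
      (∀ p' ∈ Λ n, ‖(↑(plaq W p') : 𝔸) - 1‖ < ε₁ * (c.L ^ n * c.ξ) ^ 2) →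
      (∀ p ∈ X₂.plaqs, ‖(↑(plaq (D.extU n W) p) : 𝔸) - 1‖ < B₃ * ε₁ * (c.L ^ n)⁻¹ ^ 2 * (c.L ^ n * c.ξ) ^ 2) ∧
      (∀ b ∈ X₂.bonds, ‖current π (c.L ^ n)⁻¹ (D.extU n W) b‖ < B₃ * ε₁ * (c.L ^ n * c.ξ) ^ 2))
    (havg : ∀ α : ℝ, 0 < α → α ≤ c₂ → ∀ V : PBond P 0 → 𝔸ˣ, (∀ p ∈ X.plaqs, ‖(↑(plaq V p) : 𝔸) - 1‖ < α * c.ξ ^ 2) →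
      ∀ n, 1 ≤ n → n ≤ c.j → ∀ p' ∈ Λ n, ‖(↑(plaq (D.extM n V) p') : 𝔸) - 1‖ < 2 * α * (c.L ^ n * c.ξ) ^ 2)
    (hα : 0 < α₀') (hc₂ : α₀' ≤ c₂) (ha₁ : 2 * α₀' ≤ a₁) :
    ∀ V : PBond P 0 → 𝔸ˣ, (∀ p ∈ X.plaqs, ‖(↑(plaq V p) : 𝔸) - 1‖ < α₀' * c.ξ ^ 2) → ∀ n, 1 ≤ n → n ≤ c.j →
      (∀ p ∈ X₂.plaqs, ‖(↑(plaq ((D.bgOf π c).Un n V) p) : 𝔸) - 1‖ < B₃ * (2 * α₀') * (c.L ^ n)⁻¹ ^ 2 * (c.L ^ n * c.ξ) ^ 2) ∧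
      (∀ b ∈ X₂.bonds, ‖(D.bgOf π c).Jn n V b‖ < B₃ * (2 * α₀') * (c.L ^ n * c.ξ) ^ 2) := by
  intro V hV n hn1 hnj
  exact hP9 (2 * α₀') (by positivity) ha₁ n hn1 hnj (D.extM n V) (havg α₀' hα hc₂ V hV n hn1 hnj)

/-- **(1.17) with its printed right-hand side `2B₃α₀′ξ²`** for the assembled datum: the equality `B₃2α₀′L^{−2n}(Lⁿξ)² = 2B₃α₀′ξ²` of the
display is `B12Eq117Membership.eq117_scale` (`L ≠ 0`). [cite: Balaban1987RG1, (1.17) p.263] -/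
theorem eq117_of_inputs' (π : 𝔸 →ₗ[ℂ] 𝔸) (c : StepConsts) (hL : c.L ≠ 0) (X X₂ : Region P 0) (Λ : (n : ℕ) → Set (Plaq P n))
    {B₃ a₁ c₂ α₀' : ℝ}
    (hP9 : ∀ ε₁ : ℝ, 0 < ε₁ → ε₁ ≤ a₁ → ∀ n, 1 ≤ n → n ≤ c.j → ∀ W : PBond P n → 𝔸ˣ,
      (∀ p' ∈ Λ n, ‖(↑(plaq W p') : 𝔸) - 1‖ < ε₁ * (c.L ^ n * c.ξ) ^ 2) →
      (∀ p ∈ X₂.plaqs, ‖(↑(plaq (D.extU n W) p) : 𝔸) - 1‖ < B₃ * ε₁ * (c.L ^ n)⁻¹ ^ 2 * (c.L ^ n * c.ξ) ^ 2) ∧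
      (∀ b ∈ X₂.bonds, ‖current π (c.L ^ n)⁻¹ (D.extU n W) b‖ < B₃ * ε₁ * (c.L ^ n * c.ξ) ^ 2))
    (havg : ∀ α : ℝ, 0 < α → α ≤ c₂ → ∀ V : PBond P 0 → 𝔸ˣ, (∀ p ∈ X.plaqs, ‖(↑(plaq V p) : 𝔸) - 1‖ < α * c.ξ ^ 2) →
      ∀ n, 1 ≤ n → n ≤ c.j → ∀ p' ∈ Λ n, ‖(↑(plaq (D.extM n V) p') : 𝔸) - 1‖ < 2 * α * (c.L ^ n * c.ξ) ^ 2)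
    (hα : 0 < α₀') (hc₂ : α₀' ≤ c₂) (ha₁ : 2 * α₀' ≤ a₁)
    {V : PBond P 0 → 𝔸ˣ} (hV : ∀ p ∈ X.plaqs, ‖(↑(plaq V p) : 𝔸) - 1‖ < α₀' * c.ξ ^ 2) {n : ℕ} (hn1 : 1 ≤ n) (hnj : n ≤ c.j) :
    (∀ p ∈ X₂.plaqs, ‖(↑(plaq ((D.bgOf π c).Un n V) p) : 𝔸) - 1‖ < 2 * B₃ * α₀' * c.ξ ^ 2) ∧
      (∀ b ∈ X₂.bonds, ‖(D.bgOf π c).Jn n V b‖ < B₃ * (2 * α₀') * (c.L ^ n * c.ξ) ^ 2) := by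
  obtain ⟨h1, h2⟩ := D.eq117_of_inputs π c X X₂ Λ hP9 havg hα hc₂ ha₁ V hV n hn1 hnj
  refine ⟨fun p hp => ?_, h2⟩
  have h := h1 p hp
  rwa [B12Eq117Membership.eq117_scale B₃ α₀' c.L c.ξ hL n] at h

/-- **(1.17) ⇒ (iv) for the assembled datum, from the inputs**: «It is obvious that for α₀′ sufficiently small the above estimates imply
the condition (iv)» — `2B₃α₀′ ≤ α₀` (p07's `B12Eq117Concrete.condIV_of_prop9Shape` BY NAME, fed the theorem `eq117_of_inputs`).
[cite: Balaban1987RG1, (1.17) p.263] -/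
theorem condIV_bgOf_of_inputs (π : 𝔸 →ₗ[ℂ] 𝔸) (c : StepConsts) (hL : c.L ≠ 0) (X X₂ : Region P 0)
    (Λ : (n : ℕ) → Set (Plaq P n)) {B₃ a₁ c₂ α₀' α₀ : ℝ} (hsmall : 2 * B₃ * α₀' ≤ α₀)
    (hP9 : ∀ ε₁ : ℝ, 0 < ε₁ → ε₁ ≤ a₁ → ∀ n, 1 ≤ n → n ≤ c.j → ∀ W : PBond P n → 𝔸ˣ,
      (∀ p' ∈ Λ n, ‖(↑(plaq W p') : 𝔸) - 1‖ < ε₁ * (c.L ^ n * c.ξ) ^ 2) →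
      (∀ p ∈ X₂.plaqs, ‖(↑(plaq (D.extU n W) p) : 𝔸) - 1‖ < B₃ * ε₁ * (c.L ^ n)⁻¹ ^ 2 * (c.L ^ n * c.ξ) ^ 2) ∧
      (∀ b ∈ X₂.bonds, ‖current π (c.L ^ n)⁻¹ (D.extU n W) b‖ < B₃ * ε₁ * (c.L ^ n * c.ξ) ^ 2))
    (havg : ∀ α : ℝ, 0 < α → α ≤ c₂ → ∀ V : PBond P 0 → 𝔸ˣ, (∀ p ∈ X.plaqs, ‖(↑(plaq V p) : 𝔸) - 1‖ < α * c.ξ ^ 2) →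
      ∀ n, 1 ≤ n → n ≤ c.j → ∀ p' ∈ Λ n, ‖(↑(plaq (D.extM n V) p') : 𝔸) - 1‖ < 2 * α * (c.L ^ n * c.ξ) ^ 2)
    (hα : 0 < α₀') (hc₂ : α₀' ≤ c₂) (ha₁ : 2 * α₀' ≤ a₁)
    {V : PBond P 0 → 𝔸ˣ} (hV : ∀ p ∈ X.plaqs, ‖(↑(plaq V p) : 𝔸) - 1‖ < α₀' * c.ξ ^ 2) :
    CondIV (D.bgOf π c) X₂ c α₀ V :=
  B12Eq117Concrete.condIV_of_prop9Shape hL hsmall (D.eq117_of_inputs π c X X₂ Λ hP9 havg hα hc₂ ha₁ V hV)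

end Eq117

section Membership

variable {𝔸 : Type*} [NormedRing 𝔸] [NormedAlgebra ℂ 𝔸] [CompleteSpace 𝔸] (𝓜 : Model 𝔸) {av : ∀ j, Averaging P j G}
  (D : UHalf P G 𝔸 av)

omit [CompleteSpace 𝔸] in
/-- `∇^ξ_U 0 = 0`. [folklore] -/
private theorem nabla_zero_fun (ξ : ℝ) (U : PBond P 0 → 𝔸ˣ) (μ : Fin P.d) (x : Site P 0) :
    nabla ξ U μ (fun _ => (0 : 𝔸)) x = 0 := by
  simp [nabla]

omit [CompleteSpace 𝔸] in
/-- Condition (ii) holds for `A′ = 0` as soon as `α₁ > 0`. [cite: Balaban1987RG1, (1.13) p.262] -/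
theorem condII_zero (X : Region P 0) (c : StepConsts) {α₁ : ℝ} (hα₁ : 0 < α₁) (U : PBond P 0 → 𝔸ˣ) :
    CondII 𝓜 X c α₁ U (fun _ => 0) :=
  ⟨fun _ _ => Submodule.zero_mem _, fun _ _ => by rwa [norm_zero], fun q _ => by rw [nabla_zero_fun]; rwa [norm_zero]⟩

/-- **(i)–(iii) with smaller constants ⇒ membership, ON PRINT'S INSTANCE, FROM THE INPUTS**: the membership paragraph of p. 263
(`B12Eq117Concrete.mem_space_of_prop9Shape`, p07) for the frame with the ASSEMBLED (iv)-datum, its (1.17)-hypothesis `h117` now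
DISCHARGED by the theorem `eq117_of_inputs` ((E1) [15] regularity of `U_n(·)`, ε₁ free; (E2) [12] Prop. 2 averaging bound; thresholds
`0 < α₀′ ≤ c₂`, `2α₀′ ≤ a₁`, `2B₃α₀′ ≤ α₀`; `α₀′ ≤ α₀`, `α₁′ ≤ α₁`, `γ₀′ ≤ γ₀`, `O(1)LMB ≥ 0`, `L ≠ 0`): *«thus the configuration (𝐔, 𝐉)
belongs to the space U^c_j(X, α₀, α₁)»*. [cite: Balaban1987RG1, (1.17) p.263] -/
theorem mem_space_frame_of_inputs (π : 𝔸 →ₗ[ℂ] 𝔸) {c : StepConsts} (hcB : 0 ≤ c.cB) (hL : c.L ≠ 0)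
    (X : Region P 0) (cubes : Set (Region P 0)) (X₂ : Region P 0) (Λ : (n : ℕ) → Set (Plaq P n))
    {B₃ a₁ c₂ α₀' α₁' γ₀' α₀ α₁ γ₀ : ℝ} (h₀ : α₀' ≤ α₀) (h₁ : α₁' ≤ α₁) (hγ : γ₀' ≤ γ₀) (hsmall : 2 * B₃ * α₀' ≤ α₀)
    (hP9 : ∀ ε₁ : ℝ, 0 < ε₁ → ε₁ ≤ a₁ → ∀ n, 1 ≤ n → n ≤ c.j → ∀ W : PBond P n → 𝔸ˣ,
      (∀ p' ∈ Λ n, ‖(↑(plaq W p') : 𝔸) - 1‖ < ε₁ * (c.L ^ n * c.ξ) ^ 2) →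
      (∀ p ∈ X₂.plaqs, ‖(↑(plaq (D.extU n W) p) : 𝔸) - 1‖ < B₃ * ε₁ * (c.L ^ n)⁻¹ ^ 2 * (c.L ^ n * c.ξ) ^ 2) ∧
      (∀ b ∈ X₂.bonds, ‖current π (c.L ^ n)⁻¹ (D.extU n W) b‖ < B₃ * ε₁ * (c.L ^ n * c.ξ) ^ 2))
    (havg : ∀ α : ℝ, 0 < α → α ≤ c₂ → ∀ V : PBond P 0 → 𝔸ˣ, (∀ p ∈ X.plaqs, ‖(↑(plaq V p) : 𝔸) - 1‖ < α * c.ξ ^ 2) →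
      ∀ n, 1 ≤ n → n ≤ c.j → ∀ p' ∈ Λ n, ‖(↑(plaq (D.extM n V) p') : 𝔸) - 1‖ < 2 * α * (c.L ^ n * c.ξ) ^ 2)
    (hα : 0 < α₀') (hc₂ : α₀' ≤ c₂) (ha₁ : 2 * α₀' ≤ a₁)
    {Φ : FieldPair P 0 𝔸ˣ 𝔸} (h : SatisfiesI_III 𝓜 (D.frame π c X cubes X₂) c α₀' α₁' γ₀' Φ) :
    Φ ∈ space 𝓜 (D.frame π c X cubes X₂) c α₀ α₁ γ₀ :=
  B12Eq117Concrete.mem_space_of_prop9Shape 𝓜 hcB hL h₀ h₁ hγ hsmall (D.eq117_of_inputs π c X X₂ Λ hP9 havg hα hc₂ ha₁) h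

/-- **«there are some simple and natural spaces contained in U^c_j(X, α₀, α₁)»** on print's instance, from the inputs: the set of pairs
satisfying (i)–(iii) with `(α₀′, α₁′, γ₀′)` on the assembled frame is contained in `U^c_j(X, α₀, α₁, γ₀)`. [cite: Balaban1987RG1, (1.17) p.263] -/
theorem setOf_satisfiesI_III_frame_subset_space (π : 𝔸 →ₗ[ℂ] 𝔸) {c : StepConsts} (hcB : 0 ≤ c.cB) (hL : c.L ≠ 0)
    (X : Region P 0) (cubes : Set (Region P 0)) (X₂ : Region P 0) (Λ : (n : ℕ) → Set (Plaq P n))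
    {B₃ a₁ c₂ α₀' α₁' γ₀' α₀ α₁ γ₀ : ℝ} (h₀ : α₀' ≤ α₀) (h₁ : α₁' ≤ α₁) (hγ : γ₀' ≤ γ₀) (hsmall : 2 * B₃ * α₀' ≤ α₀)
    (hP9 : ∀ ε₁ : ℝ, 0 < ε₁ → ε₁ ≤ a₁ → ∀ n, 1 ≤ n → n ≤ c.j → ∀ W : PBond P n → 𝔸ˣ,
      (∀ p' ∈ Λ n, ‖(↑(plaq W p') : 𝔸) - 1‖ < ε₁ * (c.L ^ n * c.ξ) ^ 2) →
      (∀ p ∈ X₂.plaqs, ‖(↑(plaq (D.extU n W) p) : 𝔸) - 1‖ < B₃ * ε₁ * (c.L ^ n)⁻¹ ^ 2 * (c.L ^ n * c.ξ) ^ 2) ∧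
      (∀ b ∈ X₂.bonds, ‖current π (c.L ^ n)⁻¹ (D.extU n W) b‖ < B₃ * ε₁ * (c.L ^ n * c.ξ) ^ 2))
    (havg : ∀ α : ℝ, 0 < α → α ≤ c₂ → ∀ V : PBond P 0 → 𝔸ˣ, (∀ p ∈ X.plaqs, ‖(↑(plaq V p) : 𝔸) - 1‖ < α * c.ξ ^ 2) →
      ∀ n, 1 ≤ n → n ≤ c.j → ∀ p' ∈ Λ n, ‖(↑(plaq (D.extM n V) p') : 𝔸) - 1‖ < 2 * α * (c.L ^ n * c.ξ) ^ 2)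
    (hα : 0 < α₀') (hc₂ : α₀' ≤ c₂) (ha₁ : 2 * α₀' ≤ a₁) :
    {Φ | SatisfiesI_III 𝓜 (D.frame π c X cubes X₂) c α₀' α₁' γ₀' Φ} ⊆ space 𝓜 (D.frame π c X cubes X₂) c α₀ α₁ γ₀ :=
  fun _ h => D.mem_space_frame_of_inputs 𝓜 π hcB hL X cubes X₂ Λ h₀ h₁ hγ hsmall hP9 havg hα hc₂ ha₁ h

/-- **«In particular the minimal configurations U_j satisfying the bound |∂U_j − 1| < ε₀ξ² with ε₀ sufficiently small, satisfy the
above conditions»** (p. 263, last sentence of the paragraph) FOR PRINT'S INSTANCE, FROM THE INPUTS: the minimal configuration `U_j(V)`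
of B11 (`D.U j V`, `V` a coarse field on `T⁽ʲ⁾`), read in `Gᶜ ⊆ 𝔸ˣ`, with its current `𝐉 = D^{ξ*}ξ⁻²π Im ∂U_j(V)` (1.9) ∕ (1.8), belongs
to `U^c_j(X, α₀, α₁)` of the frame with the assembled (iv)-datum — GIVEN: `ι(G) ⊆ G ⊆ Gᶜ` of the value model, condition (i) for
`ι ∘ U_j(V)` with `α₀′` (its plaquette clause (1.11) is the «|∂U_j − 1| < ε₀ξ²» of the sentence, its local-gauge clause (1.12) is [15]
(10) — B11 Thm 1 outputs, by reference), `|𝐉| < α₀′` on `X` ((1.14)), `0 < α₁′`, the constants of the membership paragraph, and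
(1.17) for the assembled datum FROM (E1) ∕ (E2) and the thresholds (`eq117_of_inputs`); the factor `U′ = exp iξ·0 = 1` ((ii) free).
p07's `B12Eq117Concrete.ofBackground_mem_space'_of_prop9Shape` BY NAME. [cite: Balaban1987RG1, (1.17) p.263] -/
theorem minimal_mem_space'_of_inputs (π : 𝔸 →ₗ[ℂ] 𝔸) (hπ : ∀ A, π A ∈ 𝓜.gc)
    (hgc : ∀ g ∈ 𝓜.Gc, ∀ A ∈ 𝓜.gc, B9Eq39Adjoint.R g A ∈ 𝓜.gc) (hιG : ∀ g, D.ι g ∈ 𝓜.G) (hGGc : 𝓜.G ≤ 𝓜.Gc)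
    {c : StepConsts} (hcB : 0 ≤ c.cB) (hL : c.L ≠ 0)
    (X : Region P 0) (cubes : Set (Region P 0)) (X₂ : Region P 0) (Λ : (n : ℕ) → Set (Plaq P n))
    {B₃ a₁ c₂ α₀' α₁' α₀ α₁ : ℝ} (h₀ : α₀' ≤ α₀) (h₁ : α₁' ≤ α₁) (hα₁' : 0 < α₁') (hsmall : 2 * B₃ * α₀' ≤ α₀)
    (hP9 : ∀ ε₁ : ℝ, 0 < ε₁ → ε₁ ≤ a₁ → ∀ n, 1 ≤ n → n ≤ c.j → ∀ W : PBond P n → 𝔸ˣ,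
      (∀ p' ∈ Λ n, ‖(↑(plaq W p') : 𝔸) - 1‖ < ε₁ * (c.L ^ n * c.ξ) ^ 2) →
      (∀ p ∈ X₂.plaqs, ‖(↑(plaq (D.extU n W) p) : 𝔸) - 1‖ < B₃ * ε₁ * (c.L ^ n)⁻¹ ^ 2 * (c.L ^ n * c.ξ) ^ 2) ∧
      (∀ b ∈ X₂.bonds, ‖current π (c.L ^ n)⁻¹ (D.extU n W) b‖ < B₃ * ε₁ * (c.L ^ n * c.ξ) ^ 2))
    (havg : ∀ α : ℝ, 0 < α → α ≤ c₂ → ∀ V : PBond P 0 → 𝔸ˣ, (∀ p ∈ X.plaqs, ‖(↑(plaq V p) : 𝔸) - 1‖ < α * c.ξ ^ 2) →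
      ∀ n, 1 ≤ n → n ≤ c.j → ∀ p' ∈ Λ n, ‖(↑(plaq (D.extM n V) p') : 𝔸) - 1‖ < 2 * α * (c.L ^ n * c.ξ) ^ 2)
    (hα : 0 < α₀') (hc₂ : α₀' ≤ c₂) (ha₁ : 2 * α₀' ≤ a₁)
    (V : GaugeField P c.j G)
    (hI : CondI 𝓜 (D.frame π c X cubes X₂) c α₀' (fun b => D.ι (D.U c.j V b)))
    (hJ : ∀ b ∈ X.bonds, ‖current π c.ξ (fun b => D.ι (D.U c.j V b)) b‖ < α₀') :
    B12Eq18Current.ofBackground π c.ξ (fun b => D.ι (D.U c.j V b)) ∈ space' 𝓜 (D.frame π c X cubes X₂) c α₀ α₁ :=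
  B12Eq117Concrete.ofBackground_mem_space'_of_prop9Shape 𝓜 hcB hL h₀ h₁ hsmall
    (D.eq117_of_inputs π c X X₂ Λ hP9 havg hα hc₂ ha₁) π hπ hgc
    (fun b => hGGc (hιG _)) (fun b => by rw [B12RegularSpaces111Mono.expI_zero, one_mul]) hI (condII_zero 𝓜 X c hα₁' _)
    hI.plaq_lt hJ

end Membership

end UHalf

end UHalf

/-! # (v1.3, APPEND-ONLY) THE CURRENT BOUND FROM [14] (1.9) FOR `G`-VALUED CONFIGURATIONS — p. 260 «(1.2) … is implied by the
condition on V, with 2ε₀ replaced by B₃⁻¹ε₀, see Theorem 1 [15]», p. 263 the minimal-`U_j` sentence with `hJ` DISCHARGED, (1.17)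
«for U instead of 𝐔» with the J-line DERIVED (§§6–10), and §11: §5's (E1) `hP9` itself DERIVED for the `Gᶜ`-valued continuation from the
[15] §G representation `U_n(V′V₀) = [e^{iηA}U_n(V₀)]^u` ((8) ∕ (19) bounds) by [I]'s own (3.11) (§§1–5 byte-identical to v1.2) -/

open Literature.MathematicalPhysics.QuantumFieldTheory.Balaban1983to89.B9Eq37Insertion
open Literature.MathematicalPhysics.QuantumFieldTheory.Balaban1983to89.B9Eq39Adjoint
open Literature.MathematicalPhysics.QuantumFieldTheory.Balaban1983to89.B9TorusCalculus
open Complex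

/-! ## §6 (v1.3). Algebra of (1.11) [14]: `D*` of an equivariant additive map -/

section Algebra

variable {𝔸 : Type*} [Ring 𝔸] {S : Type*} {ι : Type*} (T : ι → Equiv.Perm S) (U : ι → S → 𝔸ˣ)

/-- `D*_μ` of an additive map `f` commuting with the transports `R(U(b)⁻¹)` is `f` of `D*_μ` — the mechanism of [14] (1.11)
«if a function F transforms as F^u(x) = R(u(x))F(x), then (D^{η*}_{U^u,ν}F^u)(x) = R(u(x))(D^{η*}_{U,ν}F)(x)», here for a map acting on
the values. [cite: Balaban1985RegularSpaces, (1.11) p.77] -/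
theorem covDstar_map (f : 𝔸 →+ 𝔸) (hf : ∀ μ y X, f (R (U μ y)⁻¹ X) = R (U μ y)⁻¹ (f X)) (μ : ι) (G : S → 𝔸) (x : S) :
    covDstar T U μ (fun y => f (G y)) x = f (covDstar T U μ G x) := by
  simp only [covDstar, map_sub, hf]

variable [Fintype ι] [LinearOrder ι]

/-- `D*` ((1.2) [14] = (3.9) [Balaban1985BackgroundPropagators]) of an additive map commuting with the transports is the map of `D*`.
[cite: Balaban1985RegularSpaces, (1.11) p.77] -/
theorem divP_map (f : 𝔸 →+ 𝔸) (hf : ∀ μ y X, f (R (U μ y)⁻¹ X) = R (U μ y)⁻¹ (f X)) (F : ι → ι → S → 𝔸) (κ : ι) (x : S) :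
    divP T U (fun μ ν y => f (F μ ν y)) κ x = f (divP T U F κ x) := by
  have h : ∀ ν μ' ν', covDstar T U ν (fun y => f (F μ' ν' y)) x = f (covDstar T U ν (F μ' ν') x) :=
    fun ν μ' ν' => covDstar_map T U f hf ν (F μ' ν') x
  rw [divP, divP, map_sub, map_sum, map_sum]
  congr 1 <;> refine Finset.sum_congr rfl (fun ν _ => ?_) <;> split_ifs <;> simp only [map_zero, h]

variable [Algebra ℂ 𝔸]

/-- `D^{η*}` of an additive map commuting with the transports and with the real scalar `η⁻¹` is the map of `D^{η*}`.
[cite: Balaban1985RegularSpaces, (1.11) p.77] -/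
theorem divPη_map (η : ℝ) (f : 𝔸 →+ 𝔸) (hf : ∀ μ y X, f (R (U μ y)⁻¹ X) = R (U μ y)⁻¹ (f X))
    (hfη : ∀ Z, f (((η : ℂ)⁻¹) • Z) = ((η : ℂ)⁻¹) • f Z) (F : ι → ι → S → 𝔸) (κ : ι) (x : S) :
    divPη T U η (fun μ ν y => f (F μ ν y)) κ x = f (divPη T U η F κ x) := by
  rw [divPη, divPη, divP_map T U f hf, hfη]

/-- `D^{η*}` of a `ℂ`-linear map `π` commuting with the transports is `π` of `D^{η*}` (the projection `π` of (1.8) [I] on `G`-valued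
configurations). [cite: Balaban1985RegularSpaces, (1.11) p.77] -/
theorem divPη_linearMap (η : ℝ) (π : 𝔸 →ₗ[ℂ] 𝔸) (hπ : ∀ μ y X, π (R (U μ y)⁻¹ X) = R (U μ y)⁻¹ (π X))
    (F : ι → ι → S → 𝔸) (κ : ι) (x : S) :
    divPη T U η (fun μ ν y => π (F μ ν y)) κ x = π (divPη T U η F κ x) :=
  divPη_map T U η π.toAddMonoidHom hπ (fun Z => π.map_smul _ Z) F κ x

/-- `D^{η*}` commutes with scalars. [cite: Balaban1985RegularSpaces, (1.2) p.76] -/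
theorem divPη_smul' (η : ℝ) (c : ℂ) (F : ι → ι → S → 𝔸) (κ : ι) (x : S) :
    divPη T U η (c • F) κ x = c • divPη T U η F κ x := by
  rw [divPη, divPη, divP_smul, smul_comm]

end Algebra

/-! ## §7 (v1.3). Unitary values: `Im` is linear on unitaries and commutes with `D*` — [15] (28) «D*η⁻²Im ∂U₀ = Im η⁻²D*∂U₀» -/

section Star

variable {𝔸 : Type*} [Ring 𝔸] [StarRing 𝔸]

/-- The transports by unitaries commute with the star: `(R(V⁻¹)X)* = R(V⁻¹)X*` (for a unit with unitary value `W⁻¹ = W*` — the tree's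
[folklore] `B10Eq27AxialLog.val_inv_eq_star`, here the Mathlib term `Units.inv_eq_of_mul_eq_one_right (Unitary.mul_star_self_of_mem _)`
inline, that module not being below this file). [cite: Balaban1985RegularSpaces, (1.11) p.77] -/
theorem star_R_inv {V : 𝔸ˣ} (hV : (V : 𝔸) ∈ unitary 𝔸) (X : 𝔸) : star (R V⁻¹ X) = R V⁻¹ (star X) := by
  simp only [R, inv_inv, Units.inv_eq_of_mul_eq_one_right (Unitary.mul_star_self_of_mem hV), star_mul, star_star, mul_assoc]

variable {S : Type*} {ι : Type*} (T : ι → Equiv.Perm S)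

/-- The plaquette variables `U(∂p)` of a unitary-valued configuration are unitary («U has values in the group G», `G ⊂ U(N)`).
[cite: Balaban1987RG1, (1.11) p.262] -/
theorem val_plaqU_mem_unitary {U : ι → S → 𝔸ˣ} (hU : ∀ μ y, ((U μ y : 𝔸ˣ) : 𝔸) ∈ unitary 𝔸) (μ ν : ι) (x : S) :
    ((plaqU T U μ ν x : 𝔸ˣ) : 𝔸) ∈ unitary 𝔸 := by
  simp only [plaqU, Units.val_mul, Units.inv_eq_of_mul_eq_one_right (Unitary.mul_star_self_of_mem (hU _ _))]
  exact mul_mem (mul_mem (mul_mem (hU _ _) (hU _ _)) (Unitary.star_mem (hU _ _))) (Unitary.star_mem (hU _ _))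

variable [Algebra ℂ 𝔸]

/-- On unitaries «Im U = (1∕2i)(U − U⁻¹)» (p. 261) is the LINEAR imaginary part `(W − W*)∕2i`. [cite: Balaban1987RG1, (1.8) p.261] -/
theorem imC_eq_imPart {W : 𝔸ˣ} (hW : (W : 𝔸) ∈ unitary 𝔸) :
    imC W = (2 * I)⁻¹ • ((W : 𝔸) - star (W : 𝔸)) := by
  rw [imC, Units.inv_eq_of_mul_eq_one_right (Unitary.mul_star_self_of_mem hW)]

/-- The linear imaginary part commutes with the transports by unitaries. [cite: Balaban1985Variational, (28) p.282] -/
theorem imPart_R_inv {V : 𝔸ˣ} (hV : (V : 𝔸) ∈ unitary 𝔸) (X : 𝔸) :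
    (2 * I)⁻¹ • (R V⁻¹ X - star (R V⁻¹ X)) = R V⁻¹ ((2 * I)⁻¹ • (X - star X)) := by
  rw [star_R_inv hV, ← R_sub, R_smul]

variable [StarModule ℂ 𝔸]

/-- The star commutes with the real scalar `η⁻¹` of `D^{η*}`. [cite: Balaban1985Variational, (28) p.282] -/
theorem star_real_inv_smul (η : ℝ) (Z : 𝔸) : star (((η : ℂ)⁻¹) • Z) = ((η : ℂ)⁻¹) • star Z := by
  rw [star_smul, ← Complex.ofReal_inv, Complex.star_def, Complex.conj_ofReal]

variable [Fintype ι] [LinearOrder ι]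

/-- **[15] (28) «D*η⁻²Im ∂U₀ = Im η⁻²D*∂U₀» as an identity**: for a unitary-valued configuration, `D^{η*}_U` of the plaquette
function `Im ∂U` is the linear imaginary part of `D^{η*}_U ∂U` — `Im` is additive on values, commutes with the transports `R(U(b)⁻¹)`
((1.11) [14]) and with the real scalar `η⁻¹`. [cite: Balaban1985Variational, (28) p.282] -/
theorem divPη_imC_plaqU_eq {U : ι → S → 𝔸ˣ} (hU : ∀ μ y, ((U μ y : 𝔸ˣ) : 𝔸) ∈ unitary 𝔸) (η : ℝ) (κ : ι) (x : S) :
    divPη T U η (fun μ ν y => imC (plaqU T U μ ν y)) κ x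
      = (2 * I)⁻¹ • (divPη T U η (fun μ ν y => ((plaqU T U μ ν y : 𝔸ˣ) : 𝔸)) κ x
          - star (divPη T U η (fun μ ν y => ((plaqU T U μ ν y : 𝔸ˣ) : 𝔸)) κ x)) := by
  let f : 𝔸 →+ 𝔸 := AddMonoidHom.mk' (fun Y : 𝔸 => (2 * I)⁻¹ • (Y - star Y)) (by
    intro a b
    rw [star_add, ← smul_add]
    congr 1
    abel)
  have hfapp : ∀ Y, f Y = (2 * I)⁻¹ • (Y - star Y) := fun Y => rfl
  have hf : ∀ μ y X, f (R (U μ y)⁻¹ X) = R (U μ y)⁻¹ (f X) := fun μ y X => by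
    rw [hfapp, hfapp]
    exact imPart_R_inv (hU μ y) X
  have hfη : ∀ Z, f (((η : ℂ)⁻¹) • Z) = ((η : ℂ)⁻¹) • f Z := fun Z => by
    rw [hfapp, hfapp, star_real_inv_smul, ← smul_sub, smul_comm]
  have hF : (fun μ ν y => imC (plaqU T U μ ν y)) = fun μ ν y => f (((plaqU T U μ ν y : 𝔸ˣ) : 𝔸)) := by
    funext μ ν y
    rw [hfapp]
    exact imC_eq_imPart (val_plaqU_mem_unitary T hU μ ν y)
  rw [hF, divPη_map T U η f hf hfη, hfapp]

end Star

/-! ## §7′ (v1.3). The C⋆-norm: `|Im Y| ≤ |Y|`, hence `|D^{η*}(Im ∂U)| ≤ |D^{η*}∂U|` and `|J| ≤ η⁻²|D^{η*}∂U|` -/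

section Norm

variable {𝔸 : Type*} [NormedRing 𝔸] [NormedAlgebra ℂ 𝔸] [StarRing 𝔸] [CStarRing 𝔸]

/-- `|Im Y| = |(Y − Y*)∕2i| ≤ |Y|` in a C⋆-norm (`|Y*| = |Y|`). [cite: Balaban1985Variational, (28) p.282] -/
theorem norm_imPart_le (Y : 𝔸) : ‖(2 * I)⁻¹ • (Y - star Y)‖ ≤ ‖Y‖ := by
  have h2 : ‖(2 * I : ℂ)⁻¹‖ = 2⁻¹ := by
    rw [norm_inv, norm_mul, Complex.norm_two, Complex.norm_I, mul_one]
  calc ‖(2 * I)⁻¹ • (Y - star Y)‖ ≤ ‖(2 * I : ℂ)⁻¹‖ * ‖Y - star Y‖ := norm_smul_le _ _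
    _ ≤ 2⁻¹ * (‖Y‖ + ‖star Y‖) := by
        rw [h2]
        exact mul_le_mul_of_nonneg_left (norm_sub_le _ _) (by norm_num)
    _ = ‖Y‖ := by rw [norm_star]; ring

variable [StarModule ℂ 𝔸] {S : Type*} {ι : Type*} [Fintype ι] [LinearOrder ι] (T : ι → Equiv.Perm S)

/-- **`|D^{η*}_U(Im ∂U)(b)| ≤ |(D^{η*}_U ∂U)(b)|`** for a unitary-valued configuration ([15] (28) with `|Im Y| ≤ |Y|`).
[cite: Balaban1985Variational, (28) p.282] -/
theorem norm_divPη_imC_plaqU_le {U : ι → S → 𝔸ˣ} (hU : ∀ μ y, ((U μ y : 𝔸ˣ) : 𝔸) ∈ unitary 𝔸) (η : ℝ) (κ : ι) (x : S) :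
    ‖divPη T U η (fun μ ν y => imC (plaqU T U μ ν y)) κ x‖
      ≤ ‖divPη T U η (fun μ ν y => ((plaqU T U μ ν y : 𝔸ˣ) : 𝔸)) κ x‖ := by
  rw [divPη_imC_plaqU_eq T hU]
  exact norm_imPart_le _

/-- **[15] (28), the bound: `|J(b)| ≤ η⁻²|(D^{η*}_U ∂U)(b)|`** for the current `J = D^{η*}(η⁻² Im ∂U)` of (3.11)
[Balaban1985BackgroundPropagators] ∕ (28) [15] (no projection; `B9Eq39Adjoint.J`) of a unitary-valued configuration — whence print's
«|J| < C₁B₃ε₁(Lʲη)⁻³ … by the assumption (14)» from (1.9) [14]. [cite: Balaban1985Variational, (28) p.282] -/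
theorem norm_J_le_of_unitary {U : ι → S → 𝔸ˣ} (hU : ∀ μ y, ((U μ y : 𝔸ˣ) : 𝔸) ∈ unitary 𝔸) (η : ℝ) (κ : ι) (x : S) :
    ‖J T U η κ x‖ ≤ (η ^ 2)⁻¹ * ‖divPη T U η (fun μ ν y => ((plaqU T U μ ν y : 𝔸ˣ) : 𝔸)) κ x‖ := by
  have hJ : J T U η κ x = (((η : ℂ)⁻¹) ^ 2) • divPη T U η (fun μ ν y => imC (plaqU T U μ ν y)) κ x := by
    rw [J, ← divPη_smul']
    rfl
  have hc : ‖((η : ℂ)⁻¹) ^ 2‖ = (η ^ 2)⁻¹ := by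
    rw [norm_pow, norm_inv, Complex.norm_real, Real.norm_eq_abs, inv_pow, sq_abs]
  rw [hJ]
  calc ‖(((η : ℂ)⁻¹) ^ 2) • divPη T U η (fun μ ν y => imC (plaqU T U μ ν y)) κ x‖
      ≤ ‖((η : ℂ)⁻¹) ^ 2‖ * ‖divPη T U η (fun μ ν y => imC (plaqU T U μ ν y)) κ x‖ := norm_smul_le _ _
    _ ≤ (η ^ 2)⁻¹ * ‖divPη T U η (fun μ ν y => ((plaqU T U μ ν y : 𝔸ˣ) : 𝔸)) κ x‖ := by
        rw [hc]
        exact mul_le_mul_of_nonneg_left (norm_divPη_imC_plaqU_le T hU η κ x) (by positivity)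

end Norm

/-! ## §8 (v1.3). The torus: the current (1.8) with the projection `π` -/

section Torus

variable {P : Params} {i : ℕ} {𝔸 : Type*} [Ring 𝔸] [Algebra ℂ 𝔸]

/-- **(1.8) under an equivariant projection**: `J(b) = ξ⁻²·π(D^{ξ*}_U(Im ∂U)(b))` — the `ℂ`-linear `π` and the scalar `ξ⁻²` pass
through `D^{ξ*}_U` when `π` commutes with the transports `R(U(b)⁻¹)` ((1.11) [14]). [cite: Balaban1987RG1, (1.8) p.261] -/
theorem current_eq_smul_map (π : 𝔸 →ₗ[ℂ] 𝔸) (ξ : ℝ) (U : PBond P i → 𝔸ˣ)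
    (hπ : ∀ b : PBond P i, ∀ X, π (R (U b)⁻¹ X) = R (U b)⁻¹ (π X)) (b : PBond P i) :
    current π ξ U b = (((ξ : ℂ)⁻¹) ^ 2) • π (divPη (torusT P i) (dirForm U) ξ
        (fun μ ν y => imC (plaqU (torusT P i) (dirForm U) μ ν y)) b.dir b.src) := by
  have hπ' : ∀ μ y X, π (R (dirForm U μ y)⁻¹ X) = R (dirForm U μ y)⁻¹ (π X) := fun μ y X => hπ ⟨y, μ⟩ X
  have h1 : imPlaq π ξ U = (((ξ : ℂ)⁻¹) ^ 2) •
      (fun μ ν y => π (imC (plaqU (torusT P i) (dirForm U) μ ν y))) := rfl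
  show divPη (torusT P i) (dirForm U) ξ (imPlaq π ξ U) b.dir b.src = _
  rw [h1, divPη_smul', divPη_linearMap _ _ ξ π hπ']

end Torus

section TorusNorm

variable {P : Params} {i : ℕ} {𝔸 : Type*} [NormedRing 𝔸] [NormedAlgebra ℂ 𝔸] [StarRing 𝔸] [CStarRing 𝔸] [StarModule ℂ 𝔸]

/-- **`|J(b)| ≤ C_π ξ⁻² |(D^{ξ*}_U ∂U)(b)|`** for the current (1.8) of a UNITARY-valued configuration, `π` commuting with the transports
and bounded by `C_π` — print's step [15] (28) «J = D*η⁻²Im ∂U₀ = Im η⁻²D*∂U₀, |J| < …» with the projection of (1.8).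
[cite: Balaban1987RG1, (1.8) p.261] -/
theorem norm_current_le_of_unitary (π : 𝔸 →ₗ[ℂ] 𝔸) (ξ : ℝ) (U : PBond P i → 𝔸ˣ)
    (hU : ∀ b, ((U b : 𝔸ˣ) : 𝔸) ∈ unitary 𝔸) (hπ : ∀ b : PBond P i, ∀ X, π (R (U b)⁻¹ X) = R (U b)⁻¹ (π X))
    {Cπ : ℝ} (hC0 : 0 ≤ Cπ) (hCπ : ∀ X, ‖π X‖ ≤ Cπ * ‖X‖) (b : PBond P i) :
    ‖current π ξ U b‖ ≤ Cπ * (ξ ^ 2)⁻¹ *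
      ‖divPη (torusT P i) (dirForm U) ξ (fun μ ν y => ((plaqU (torusT P i) (dirForm U) μ ν y : 𝔸ˣ) : 𝔸)) b.dir b.src‖ := by
  have hU' : ∀ μ y, ((dirForm U μ y : 𝔸ˣ) : 𝔸) ∈ unitary 𝔸 := fun μ y => hU ⟨y, μ⟩
  have hc : ‖((ξ : ℂ)⁻¹) ^ 2‖ = (ξ ^ 2)⁻¹ := by
    rw [norm_pow, norm_inv, Complex.norm_real, Real.norm_eq_abs, inv_pow, sq_abs]
  rw [current_eq_smul_map π ξ U hπ b]
  calc ‖(((ξ : ℂ)⁻¹) ^ 2) • π (divPη (torusT P i) (dirForm U) ξ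
          (fun μ ν y => imC (plaqU (torusT P i) (dirForm U) μ ν y)) b.dir b.src)‖
      ≤ ‖((ξ : ℂ)⁻¹) ^ 2‖ * ‖π (divPη (torusT P i) (dirForm U) ξ
          (fun μ ν y => imC (plaqU (torusT P i) (dirForm U) μ ν y)) b.dir b.src)‖ := norm_smul_le _ _
    _ ≤ (ξ ^ 2)⁻¹ * (Cπ * ‖divPη (torusT P i) (dirForm U) ξ
          (fun μ ν y => ((plaqU (torusT P i) (dirForm U) μ ν y : 𝔸ˣ) : 𝔸)) b.dir b.src‖) := by
        rw [hc]
        refine mul_le_mul_of_nonneg_left ((hCπ _).trans ?_) (by positivity)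
        exact mul_le_mul_of_nonneg_left (norm_divPη_imC_plaqU_le _ hU' ξ b.dir b.src) hC0
    _ = _ := by ring

end TorusNorm

/-! ## §9 (v1.3). p. 260: the «⇐» claim of (1.2) — «implied by the condition on V, with 2ε₀ replaced by B₃⁻¹ε₀, see Theorem 1 [15]» -/

section Eq12

variable {P : Params} {i : ℕ} {𝔸 : Type*} [NormedRing 𝔸] [NormedAlgebra ℂ 𝔸] [StarRing 𝔸] [CStarRing 𝔸] [StarModule ℂ 𝔸]

omit [NormedAlgebra ℂ 𝔸] [StarRing 𝔸] [CStarRing 𝔸] [StarModule ℂ 𝔸] in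
/-- At the top level `Lᵏη = 1` (`η = L⁻ᵏ = (Lᵏ)⁻¹`, the tree's `BIJ85SmoothGaugeRegular17.eta_eq_inv_pow` — not below this file —
inline). [cite: Balaban1987RG1, (1.2) p.260] -/
theorem pow_mul_eta (P : Params) (k : ℕ) : (P.L : ℝ) ^ k * P.eta k = 1 := by
  rw [Params.eta, inv_pow]
  exact mul_inv_cancel₀ (pow_ne_zero _ (Nat.cast_ne_zero.2 P.L_pos.ne'))

omit [NormedAlgebra ℂ 𝔸] [StarRing 𝔸] [CStarRing 𝔸] [StarModule ℂ 𝔸] in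
/-- The plaquette variable of a configuration read through a group homomorphism is the image of the plaquette variable
(`|U(∂p) − 1|` read in `𝔸` for a `G`-valued `U`, `ι : G →* 𝔸ˣ`). [cite: Balaban1987RG1, (1.11) p.262] -/
theorem plaq_comp_hom {M N : Type*} [Group M] [Group N] (φ : M →* N) (W : PBond P i → M) (p : Plaq P i) :
    plaq (fun b => φ (W b)) p = φ (plaq W p) := by
  simp only [plaq_eq, map_mul, map_inv]

/-- **p. 260, the «⇐» claim of (1.2), from the clause-(8) space of Theorem 1 [15] read through [14] (1.7) ∕ (1.9).**  A
UNITARY-valued configuration `U` on `T_η = T⁽⁰⁾`, `η = L⁻ᵏ`, lying in `𝔘_k({Ω_j ≡ T}, α)` at the top level `j = k` — (1.7) [14]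
«|U(∂p) − 1| < α₀L^{−2j}» and (1.9) [14] «|(D^{η*}_U ∂U)(b)| < α₀L^{−2j}(Lʲη)⁻¹» with `α₀ = α`, `j = k` — satisfies (1.2):
`|U(∂p) − 1| < αη²` on `T` and `|J(b)| < C_π α` on `T`, `J = D^{η*}_U η⁻²π Im ∂U` (1.8) WITH BODY (`B12Eq18Current.current`), for a
`ℂ`-linear `π` commuting with the transports `R(U(b)⁻¹)` and bounded by `C_π > 0` (print: `C_π = 1`, `eq12_of_thm1`).  Route = [15]
(28): `|J(b)| ≤ C_π η⁻²|(D^{η*}_U∂U)(b)|` (`norm_current_le_of_unitary`) and `Lᵏη = 1`. [cite: Balaban1987RG1, (1.2) p.260] -/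
theorem eq12_of_membership (π : 𝔸 →ₗ[ℂ] 𝔸) {Cπ : ℝ} (hC0 : 0 < Cπ) (hCπ : ∀ X, ‖π X‖ ≤ Cπ * ‖X‖) (k : ℕ)
    (U : PBond P 0 → 𝔸ˣ) (hU : ∀ b, ((U b : 𝔸ˣ) : 𝔸) ∈ unitary 𝔸)
    (hπ : ∀ b : PBond P 0, ∀ X, π (R (U b)⁻¹ X) = R (U b)⁻¹ (π X)) {α : ℝ}
    (h17 : ∀ p : Plaq P 0, ‖((plaq U p : 𝔸ˣ) : 𝔸) - 1‖ < α * ((P.L : ℝ) ^ k)⁻¹ ^ 2)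
    (h19 : ∀ b : PBond P 0, ‖divPη (torusT P 0) (dirForm U) (P.eta k)
        (fun μ ν y => ((plaqU (torusT P 0) (dirForm U) μ ν y : 𝔸ˣ) : 𝔸)) b.dir b.src‖
        < α * ((P.L : ℝ) ^ k)⁻¹ ^ 2 * ((P.L : ℝ) ^ k * P.eta k)⁻¹) :
    (∀ p : Plaq P 0, ‖((plaq U p : 𝔸ˣ) : 𝔸) - 1‖ < α * (P.eta k) ^ 2) ∧
      ∀ b : PBond P 0, ‖current π (P.eta k) U b‖ < Cπ * α := by
  have hη : P.eta k = ((P.L : ℝ) ^ k)⁻¹ := by rw [Params.eta, inv_pow]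
  have hη0 : P.eta k ≠ 0 := by
    rw [hη]
    exact inv_ne_zero (pow_ne_zero _ (Nat.cast_ne_zero.2 P.L_pos.ne'))
  refine ⟨fun p => by rw [hη]; exact h17 p, fun b => ?_⟩
  have hY := h19 b
  rw [pow_mul_eta, inv_one, mul_one, ← hη] at hY
  have hpos : 0 < Cπ * ((P.eta k) ^ 2)⁻¹ := mul_pos hC0 (by positivity)
  calc ‖current π (P.eta k) U b‖
      ≤ Cπ * ((P.eta k) ^ 2)⁻¹ * ‖divPη (torusT P 0) (dirForm U) (P.eta k)
          (fun μ ν y => ((plaqU (torusT P 0) (dirForm U) μ ν y : 𝔸ˣ) : 𝔸)) b.dir b.src‖ :=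
        norm_current_le_of_unitary π (P.eta k) U hU hπ hC0.le hCπ b
    _ < Cπ * ((P.eta k) ^ 2)⁻¹ * (α * (P.eta k) ^ 2) := mul_lt_mul_of_pos_left hY hpos
    _ = Cπ * α := by field_simp

variable {G : Type*} [GaugeGroup G] {av : ∀ j, Averaging P j G}

/-- **p. 260, verbatim: «|U(∂p) − 1| < ε₀η², p ∈ T, |J| < ε₀ on T … is implied by the condition on V, with 2ε₀ replaced by B₃⁻¹ε₀,
see Theorem 1 [15]» — PROVED AT PRINT'S SEAM for B11's minimiser `U_k(V)` (`Setup.Background.U k`) read in `𝔸` through a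
unitary-valued `ι : G →* 𝔸ˣ` (`G ⊂ U(N)`).**  INPUT `hThm1` = Theorem 1 [15] in the shape of its clause (8), BY REFERENCE (rows B11.Thm1,
B8.Eq1.7-1.9): for `V` on `T₁⁽ᵏ⁾` with «|(∂V)(p′) − 1| < ε₁» ((7) p. 278; `Setup.PlaqSmall ε₁ V`, the letter of (1.1)) and `0 < ε₁ ≤ a₁`,
the minimiser `U_k(V)` lies in `𝔘_k({Ω_j ≡ T}, B₃ε₁)`, i.e. satisfies [14] (1.7) and (1.9) (top level `j = k`, all of `T`).  OUTPUT: for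
every `V` with `|V(∂p′) − 1| < B₃⁻¹ε₀` (`0 < ε₀ ≤ B₃a₁`), `|U_k(V)(∂p) − 1| < ε₀η²` and `|J(b)| < ε₀` on `T` with `J` = (1.8) WITH BODY at
`ξ = η` — (1.2) with `ε₀ = B₃ε₁`; here for `π` with `|πX| ≤ |X|` commuting with `Ad(G)` (print's case `C_π = 1`; general `C_π`:
`eq12_of_thm1'`). [cite: Balaban1987RG1, (1.2) p.260] -/
theorem eq12_of_thm1 (bg : Background P G av) (ι : G →* 𝔸ˣ) (hιu : ∀ g, ((ι g : 𝔸ˣ) : 𝔸) ∈ unitary 𝔸)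
    (π : 𝔸 →ₗ[ℂ] 𝔸) (hπ : ∀ g X, π (R (ι g)⁻¹ X) = R (ι g)⁻¹ (π X)) (hπ1 : ∀ X, ‖π X‖ ≤ ‖X‖)
    (k : ℕ) {B₃ a₁ ε₀ : ℝ} (hB₃ : 0 < B₃) (hε : 0 < ε₀) (hε₀ : ε₀ ≤ B₃ * a₁)
    (hThm1 : ∀ ε₁ : ℝ, 0 < ε₁ → ε₁ ≤ a₁ → ∀ V : GaugeField P k G, PlaqSmall ε₁ V →
      (∀ p : Plaq P 0, ‖((plaq (fun b => ι (bg.U k V b)) p : 𝔸ˣ) : 𝔸) - 1‖ < B₃ * ε₁ * ((P.L : ℝ) ^ k)⁻¹ ^ 2) ∧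
      (∀ b : PBond P 0, ‖divPη (torusT P 0) (dirForm fun b => ι (bg.U k V b)) (P.eta k)
          (fun μ ν y => ((plaqU (torusT P 0) (dirForm fun b => ι (bg.U k V b)) μ ν y : 𝔸ˣ) : 𝔸)) b.dir b.src‖
          < B₃ * ε₁ * ((P.L : ℝ) ^ k)⁻¹ ^ 2 * ((P.L : ℝ) ^ k * P.eta k)⁻¹))
    (V : GaugeField P k G) (hV : PlaqSmall (B₃⁻¹ * ε₀) V) :
    (∀ p : Plaq P 0, ‖((plaq (fun b => ι (bg.U k V b)) p : 𝔸ˣ) : 𝔸) - 1‖ < ε₀ * (P.eta k) ^ 2) ∧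
      ∀ b : PBond P 0, ‖current π (P.eta k) (fun b => ι (bg.U k V b)) b‖ < ε₀ := by
  have hε₁ : 0 < B₃⁻¹ * ε₀ := mul_pos (inv_pos.2 hB₃) hε
  have hε₁' : B₃⁻¹ * ε₀ ≤ a₁ := by
    rw [inv_mul_le_iff₀ hB₃]
    exact hε₀
  obtain ⟨h17, h19⟩ := hThm1 (B₃⁻¹ * ε₀) hε₁ hε₁' V hV
  have hBε : B₃ * (B₃⁻¹ * ε₀) = ε₀ := mul_inv_cancel_left₀ hB₃.ne' ε₀
  rw [hBε] at h17 h19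
  have h := eq12_of_membership π one_pos (fun X => by rw [one_mul]; exact hπ1 X) k (fun b => ι (bg.U k V b))
    (fun b => hιu _) (fun b X => hπ _ X) h17 h19
  simpa only [one_mul] using h

/-- The same for a general bound `|πX| ≤ C_π|X|`, `C_π > 0`: (1.2) with `(ε₀, C_π ε₀)` — print's constants are generic.
[cite: Balaban1987RG1, (1.2) p.260] -/
theorem eq12_of_thm1' (bg : Background P G av) (ι : G →* 𝔸ˣ) (hιu : ∀ g, ((ι g : 𝔸ˣ) : 𝔸) ∈ unitary 𝔸)
    (π : 𝔸 →ₗ[ℂ] 𝔸) (hπ : ∀ g X, π (R (ι g)⁻¹ X) = R (ι g)⁻¹ (π X)) {Cπ : ℝ} (hC0 : 0 < Cπ) (hCπ : ∀ X, ‖π X‖ ≤ Cπ * ‖X‖)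
    (k : ℕ) {B₃ a₁ ε₀ : ℝ} (hB₃ : 0 < B₃) (hε : 0 < ε₀) (hε₀ : ε₀ ≤ B₃ * a₁)
    (hThm1 : ∀ ε₁ : ℝ, 0 < ε₁ → ε₁ ≤ a₁ → ∀ V : GaugeField P k G, PlaqSmall ε₁ V →
      (∀ p : Plaq P 0, ‖((plaq (fun b => ι (bg.U k V b)) p : 𝔸ˣ) : 𝔸) - 1‖ < B₃ * ε₁ * ((P.L : ℝ) ^ k)⁻¹ ^ 2) ∧
      (∀ b : PBond P 0, ‖divPη (torusT P 0) (dirForm fun b => ι (bg.U k V b)) (P.eta k)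
          (fun μ ν y => ((plaqU (torusT P 0) (dirForm fun b => ι (bg.U k V b)) μ ν y : 𝔸ˣ) : 𝔸)) b.dir b.src‖
          < B₃ * ε₁ * ((P.L : ℝ) ^ k)⁻¹ ^ 2 * ((P.L : ℝ) ^ k * P.eta k)⁻¹))
    (V : GaugeField P k G) (hV : PlaqSmall (B₃⁻¹ * ε₀) V) :
    (∀ p : Plaq P 0, ‖((plaq (fun b => ι (bg.U k V b)) p : 𝔸ˣ) : 𝔸) - 1‖ < ε₀ * (P.eta k) ^ 2) ∧
      ∀ b : PBond P 0, ‖current π (P.eta k) (fun b => ι (bg.U k V b)) b‖ < Cπ * ε₀ := by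
  have hε₁ : 0 < B₃⁻¹ * ε₀ := mul_pos (inv_pos.2 hB₃) hε
  have hε₁' : B₃⁻¹ * ε₀ ≤ a₁ := by
    rw [inv_mul_le_iff₀ hB₃]
    exact hε₀
  obtain ⟨h17, h19⟩ := hThm1 (B₃⁻¹ * ε₀) hε₁ hε₁' V hV
  have hBε : B₃ * (B₃⁻¹ * ε₀) = ε₀ := mul_inv_cancel_left₀ hB₃.ne' ε₀
  rw [hBε] at h17 h19
  exact eq12_of_membership π hC0 hCπ k (fun b => ι (bg.U k V b)) (fun b => hιu _) (fun b X => hπ _ X) h17 h19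

/-- **THE OBJECT OF ROW B12.Eq1.2**: under the same inputs the pair `(U_k(V), J(U_k(V)))` belongs to `Setup.RegularSpace P k ε₀` =
«U_k(ε₀)» of (1.2) (typed WITH BODY in `Setup`: `PlaqSmall (ε₀η²)` in the letters `dist1` of the value data, and `|J(b)| < ε₀`),
when the value data's `dist1` is dominated by the norm distance in `𝔸` (`dist1 g ≤ |ι g − 1|`; equality in the cell's `U(N)` ∕ `SU(N)`
instances). [cite: Balaban1987RG1, (1.2) p.260] -/
theorem mem_regularSpace_of_thm1 (bg : Background P G av) (ι : G →* 𝔸ˣ) (hιu : ∀ g, ((ι g : 𝔸ˣ) : 𝔸) ∈ unitary 𝔸)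
    (hdist : ∀ g : G, dist1 g ≤ ‖((ι g : 𝔸ˣ) : 𝔸) - 1‖)
    (π : 𝔸 →ₗ[ℂ] 𝔸) (hπ : ∀ g X, π (R (ι g)⁻¹ X) = R (ι g)⁻¹ (π X)) (hπ1 : ∀ X, ‖π X‖ ≤ ‖X‖)
    (k : ℕ) {B₃ a₁ ε₀ : ℝ} (hB₃ : 0 < B₃) (hε : 0 < ε₀) (hε₀ : ε₀ ≤ B₃ * a₁)
    (hThm1 : ∀ ε₁ : ℝ, 0 < ε₁ → ε₁ ≤ a₁ → ∀ V : GaugeField P k G, PlaqSmall ε₁ V →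
      (∀ p : Plaq P 0, ‖((plaq (fun b => ι (bg.U k V b)) p : 𝔸ˣ) : 𝔸) - 1‖ < B₃ * ε₁ * ((P.L : ℝ) ^ k)⁻¹ ^ 2) ∧
      (∀ b : PBond P 0, ‖divPη (torusT P 0) (dirForm fun b => ι (bg.U k V b)) (P.eta k)
          (fun μ ν y => ((plaqU (torusT P 0) (dirForm fun b => ι (bg.U k V b)) μ ν y : 𝔸ˣ) : 𝔸)) b.dir b.src‖
          < B₃ * ε₁ * ((P.L : ℝ) ^ k)⁻¹ ^ 2 * ((P.L : ℝ) ^ k * P.eta k)⁻¹))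
    (V : GaugeField P k G) (hV : PlaqSmall (B₃⁻¹ * ε₀) V) :
    (⟨bg.U k V, current π (P.eta k) (fun b => ι (bg.U k V b))⟩ : FieldPair P 0 G 𝔸) ∈ RegularSpace P k ε₀ := by
  obtain ⟨h1, h2⟩ := eq12_of_thm1 bg ι hιu π hπ hπ1 k hB₃ hε hε₀ hThm1 V hV
  refine ⟨fun p => ?_, h2⟩
  have hp := h1 p
  rw [plaq_comp_hom] at hp
  exact (hdist _).trans_lt hp

end Eq12

/-! ## §10 (v1.3). p. 263 over the assembled datum `UHalf` (own v1.2): the minimal-`U_j` sentence with `hJ` discharged, and (1.17) for the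
`G`-valued factor from the clause-(8) shape -/

section UHalfReal

namespace UHalf

variable {P : Params} {G : Type*} [GaugeGroup G] {𝔸 : Type*} [NormedRing 𝔸] [NormedAlgebra ℂ 𝔸] [CompleteSpace 𝔸] [StarRing 𝔸]
  [CStarRing 𝔸] [StarModule ℂ 𝔸] (𝓜 : Model 𝔸) {av : ∀ j, Averaging P j G} (D : UHalf P G 𝔸 av)

/-- **p. 263, last sentence — «In particular the minimal configurations U_j satisfying the bound |∂U_j − 1| < ε₀ξ² with ε₀ sufficiently
small, satisfy the above conditions» — with the current hypothesis DISCHARGED.**  As `UHalf.minimal_mem_space'_of_inputs` (v1.2: the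
minimal configuration `U_j(V)` of B11 read in `Gᶜ ⊆ 𝔸ˣ` with its current (1.8) belongs to `U^c_j(X, α₀, α₁)` of the frame with the
assembled (iv)-datum), but its hypothesis `hJ : |J(b)| < α₀′ on X` is now DERIVED from the clause-(8) membership of `U_j(V)` read through
[14] (1.9) at the top level (`L^{−2j} ↦ ξ²`, `Lʲη ↦ 1` in the units of §1 [I]): `|(D^{ξ*}∂U_j(V))(b)| < α₀′ξ²` on `X` (`h19`; rows
B11.Thm1, B8.Eq1.7-1.9 by reference), for `G ⊂ U(N)` (`ι` unitary-valued) and `π` commuting with `Ad(G)` with `|πX| ≤ |X|`.  What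
stays as in v1.2: condition (i) for `ι ∘ U_j(V)` (`hI`: its (1.11) clause is the sentence's own hypothesis, its (1.12) clause is [15]
(9)–(10)), the (1.17)-inputs `hP9` ∕ `havg` of the `Gᶜ`-valued datum, the thresholds. [cite: Balaban1987RG1, (1.17) p.263] -/
theorem minimal_mem_space'_of_membership (π : 𝔸 →ₗ[ℂ] 𝔸) (hπ : ∀ A, π A ∈ 𝓜.gc)
    (hgc : ∀ g ∈ 𝓜.Gc, ∀ A ∈ 𝓜.gc, B9Eq39Adjoint.R g A ∈ 𝓜.gc) (hιG : ∀ g, D.ι g ∈ 𝓜.G) (hGGc : 𝓜.G ≤ 𝓜.Gc)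
    (hιu : ∀ g, ((D.ι g : 𝔸ˣ) : 𝔸) ∈ unitary 𝔸) (hπR : ∀ g X, π (R (D.ι g)⁻¹ X) = R (D.ι g)⁻¹ (π X))
    (hπ1 : ∀ X, ‖π X‖ ≤ ‖X‖)
    {c : StepConsts} (hcB : 0 ≤ c.cB) (hL : c.L ≠ 0) (hξ : 0 < c.ξ)
    (X : Region P 0) (cubes : Set (Region P 0)) (X₂ : Region P 0) (Λ : (n : ℕ) → Set (Plaq P n))
    {B₃ a₁ c₂ α₀' α₁' α₀ α₁ : ℝ} (h₀ : α₀' ≤ α₀) (h₁ : α₁' ≤ α₁) (hα₁' : 0 < α₁') (hsmall : 2 * B₃ * α₀' ≤ α₀)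
    (hP9 : ∀ ε₁ : ℝ, 0 < ε₁ → ε₁ ≤ a₁ → ∀ n, 1 ≤ n → n ≤ c.j → ∀ W : PBond P n → 𝔸ˣ,
      (∀ p' ∈ Λ n, ‖(↑(plaq W p') : 𝔸) - 1‖ < ε₁ * (c.L ^ n * c.ξ) ^ 2) →
      (∀ p ∈ X₂.plaqs, ‖(↑(plaq (D.extU n W) p) : 𝔸) - 1‖ < B₃ * ε₁ * (c.L ^ n)⁻¹ ^ 2 * (c.L ^ n * c.ξ) ^ 2) ∧
      (∀ b ∈ X₂.bonds, ‖current π (c.L ^ n)⁻¹ (D.extU n W) b‖ < B₃ * ε₁ * (c.L ^ n * c.ξ) ^ 2))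
    (havg : ∀ α : ℝ, 0 < α → α ≤ c₂ → ∀ V : PBond P 0 → 𝔸ˣ, (∀ p ∈ X.plaqs, ‖(↑(plaq V p) : 𝔸) - 1‖ < α * c.ξ ^ 2) →
      ∀ n, 1 ≤ n → n ≤ c.j → ∀ p' ∈ Λ n, ‖(↑(plaq (D.extM n V) p') : 𝔸) - 1‖ < 2 * α * (c.L ^ n * c.ξ) ^ 2)
    (hα : 0 < α₀') (hc₂ : α₀' ≤ c₂) (ha₁ : 2 * α₀' ≤ a₁)
    (V : GaugeField P c.j G)
    (hI : CondI 𝓜 (D.frame π c X cubes X₂) c α₀' (fun b => D.ι (D.U c.j V b)))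
    (h19 : ∀ b ∈ X.bonds, ‖divPη (torusT P 0) (dirForm fun b => D.ι (D.U c.j V b)) c.ξ
        (fun μ ν y => ((plaqU (torusT P 0) (dirForm fun b => D.ι (D.U c.j V b)) μ ν y : 𝔸ˣ) : 𝔸)) b.dir b.src‖
        < α₀' * c.ξ ^ 2) :
    B12Eq18Current.ofBackground π c.ξ (fun b => D.ι (D.U c.j V b)) ∈ space' 𝓜 (D.frame π c X cubes X₂) c α₀ α₁ := by
  refine D.minimal_mem_space'_of_inputs 𝓜 π hπ hgc hιG hGGc hcB hL X cubes X₂ Λ h₀ h₁ hα₁' hsmall hP9 havg hα hc₂ ha₁ V hI ?_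
  intro b hb
  have hpos : 0 < (1 : ℝ) * (c.ξ ^ 2)⁻¹ := by positivity
  calc ‖current π c.ξ (fun b => D.ι (D.U c.j V b)) b‖
      ≤ 1 * (c.ξ ^ 2)⁻¹ * ‖divPη (torusT P 0) (dirForm fun b => D.ι (D.U c.j V b)) c.ξ
          (fun μ ν y => ((plaqU (torusT P 0) (dirForm fun b => D.ι (D.U c.j V b)) μ ν y : 𝔸ˣ) : 𝔸)) b.dir b.src‖ :=
        norm_current_le_of_unitary π c.ξ _ (fun b => hιu _) (fun b X => hπR _ X) zero_le_one
          (fun X => by rw [one_mul]; exact hπ1 X) b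
    _ < 1 * (c.ξ ^ 2)⁻¹ * (α₀' * c.ξ ^ 2) := mul_lt_mul_of_pos_left (h19 b hb) hpos
    _ = α₀' := by field_simp

omit [CompleteSpace 𝔸] in
/-- **(1.16) ∕ (1.17) «and the same bounds hold for U instead of 𝐔» — BOTH LINES of (1.17) for the `G`-valued factor, the J-line
DERIVED.**  For a `G`-valued `𝐔_g` (read in `𝔸` through the unitary-valued `ι`) with `|∂𝐔_g − 1| < α₀′ξ²` on `X`, the assembled datum
(`UHalf.bgOf`: `U_n(M^n(𝐔_g))` = B11's minimiser of B8's n-fold average, `bgOf_Un_real`; `J_n` = (1.8) at `L⁻ⁿ`, `bgOf_Jn`) satisfies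
`|∂U_n(M˙(𝐔_g)) − 1| < B₃2α₀′L⁻²ⁿ(Lⁿξ)²` on `X̃⁻²` and `|J_n(M˙(𝐔_g))| < C_π·B₃2α₀′(Lⁿξ)²` on `X̃⁻²`, FROM: (E1ʳ) `hThm1` = Theorem 1 [15]
clause (8) for B11's OWN minimiser `Background.U n` (no continuation, NO J-line hypothesis): for `0 < ε₁ ≤ a₁` and a `G`-valued `W` on
`T⁽ⁿ⁾` with `|∂W − 1| < ε₁(Lⁿξ)²` on `Λ_n`, `U_n(W)` satisfies on `X̃⁻²` [14] (1.7) «|U(∂p) − 1| < α₀L^{−2j}» and (1.9)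
«|(D^{η*}_U∂U)(b)| < α₀L^{−2j}(Lʲη)⁻¹» with `α₀ = B₃ε₁(Lⁿξ)²`, `j = n`, `η = L⁻ⁿ` (rows B11.Thm1, B8.Eq1.7-1.9 BY REFERENCE); (E2ʳ) `havg`
= [12] Prop. 2 (54) for `G`-valued fields («|Ū^n(∂p) − 1| < 2α₀», row B7.Prop2 BY REFERENCE, `Averaging.iter av n` BY NAME); the
thresholds `0 < α₀′ ≤ c₂`, `2α₀′ ≤ a₁`; `π` commuting with `Ad(G)`, `|πX| ≤ C_π|X|`, `C_π > 0` (print: `C_π = 1`,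
`eq117_real_of_membership'`). [cite: Balaban1987RG1, (1.17) p.263] -/
theorem eq117_real_of_membership (π : 𝔸 →ₗ[ℂ] 𝔸) (c : StepConsts) (hL : c.L ≠ 0) (X X₂ : Region P 0)
    (Λ : (n : ℕ) → Set (Plaq P n)) (hιu : ∀ g, ((D.ι g : 𝔸ˣ) : 𝔸) ∈ unitary 𝔸)
    (hπR : ∀ g X, π (R (D.ι g)⁻¹ X) = R (D.ι g)⁻¹ (π X)) {Cπ : ℝ} (hC0 : 0 < Cπ) (hCπ : ∀ X, ‖π X‖ ≤ Cπ * ‖X‖)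
    {B₃ a₁ c₂ α₀' : ℝ}
    (hThm1 : ∀ ε₁ : ℝ, 0 < ε₁ → ε₁ ≤ a₁ → ∀ n, 1 ≤ n → n ≤ c.j → ∀ W : GaugeField P n G,
      (∀ p' ∈ Λ n, ‖((plaq (fun b => D.ι (W b)) p' : 𝔸ˣ) : 𝔸) - 1‖ < ε₁ * (c.L ^ n * c.ξ) ^ 2) →
      (∀ p ∈ X₂.plaqs, ‖((plaq (fun b => D.ι (D.U n W b)) p : 𝔸ˣ) : 𝔸) - 1‖
          < B₃ * ε₁ * (c.L ^ n * c.ξ) ^ 2 * (c.L ^ n)⁻¹ ^ 2) ∧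
      (∀ b ∈ X₂.bonds, ‖divPη (torusT P 0) (dirForm fun b => D.ι (D.U n W b)) (c.L ^ n)⁻¹
          (fun μ ν y => ((plaqU (torusT P 0) (dirForm fun b => D.ι (D.U n W b)) μ ν y : 𝔸ˣ) : 𝔸)) b.dir b.src‖
          < B₃ * ε₁ * (c.L ^ n * c.ξ) ^ 2 * (c.L ^ n)⁻¹ ^ 2 * (c.L ^ n * (c.L ^ n)⁻¹)⁻¹))
    (havg : ∀ α : ℝ, 0 < α → α ≤ c₂ → ∀ Ug : GaugeField P 0 G,
      (∀ p ∈ X.plaqs, ‖((plaq (fun b => D.ι (Ug b)) p : 𝔸ˣ) : 𝔸) - 1‖ < α * c.ξ ^ 2) →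
      ∀ n, 1 ≤ n → n ≤ c.j → ∀ p' ∈ Λ n,
        ‖((plaq (fun b => D.ι (Averaging.iter av n Ug b)) p' : 𝔸ˣ) : 𝔸) - 1‖ < 2 * α * (c.L ^ n * c.ξ) ^ 2)
    (hα : 0 < α₀') (hc₂ : α₀' ≤ c₂) (ha₁ : 2 * α₀' ≤ a₁)
    (Ug : GaugeField P 0 G) (hUg : ∀ p ∈ X.plaqs, ‖((plaq (fun b => D.ι (Ug b)) p : 𝔸ˣ) : 𝔸) - 1‖ < α₀' * c.ξ ^ 2)
    {n : ℕ} (hn1 : 1 ≤ n) (hnj : n ≤ c.j) :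
    (∀ p ∈ X₂.plaqs, ‖((plaq ((D.bgOf π c).Un n (fun b => D.ι (Ug b))) p : 𝔸ˣ) : 𝔸) - 1‖
        < B₃ * (2 * α₀') * (c.L ^ n)⁻¹ ^ 2 * (c.L ^ n * c.ξ) ^ 2) ∧
      (∀ b ∈ X₂.bonds, ‖(D.bgOf π c).Jn n (fun b => D.ι (Ug b)) b‖ < Cπ * (B₃ * (2 * α₀') * (c.L ^ n * c.ξ) ^ 2)) := by
  have hLn : c.L ^ n ≠ 0 := pow_ne_zero _ hL
  have hW := havg α₀' hα hc₂ Ug hUg n hn1 hnj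
  obtain ⟨h17, h19⟩ := hThm1 (2 * α₀') (by positivity) ha₁ n hn1 hnj (Averaging.iter av n Ug) hW
  have hUn : (D.bgOf π c).Un n (fun b => D.ι (Ug b)) = fun b => D.ι (D.U n (Averaging.iter av n Ug) b) :=
    D.bgOf_Un_real π c n Ug
  refine ⟨fun p hp => ?_, fun b hb => ?_⟩
  · rw [hUn]
    have h := h17 p hp
    calc ‖((plaq (fun b => D.ι (D.U n (Averaging.iter av n Ug) b)) p : 𝔸ˣ) : 𝔸) - 1‖
        < B₃ * (2 * α₀') * (c.L ^ n * c.ξ) ^ 2 * (c.L ^ n)⁻¹ ^ 2 := h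
      _ = B₃ * (2 * α₀') * (c.L ^ n)⁻¹ ^ 2 * (c.L ^ n * c.ξ) ^ 2 := by ring
  · rw [D.bgOf_Jn π c n, D.extU_extM_real n Ug]
    have hY := h19 b hb
    rw [mul_inv_cancel₀ hLn, inv_one, mul_one] at hY
    have hpos : 0 < Cπ * (((c.L ^ n)⁻¹) ^ 2)⁻¹ := mul_pos hC0 (by positivity)
    calc ‖current π (c.L ^ n)⁻¹ (fun b => D.ι (D.U n (Averaging.iter av n Ug) b)) b‖
        ≤ Cπ * (((c.L ^ n)⁻¹) ^ 2)⁻¹ * ‖divPη (torusT P 0) (dirForm fun b => D.ι (D.U n (Averaging.iter av n Ug) b))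
            (c.L ^ n)⁻¹ (fun μ ν y => ((plaqU (torusT P 0)
              (dirForm fun b => D.ι (D.U n (Averaging.iter av n Ug) b)) μ ν y : 𝔸ˣ) : 𝔸)) b.dir b.src‖ :=
          norm_current_le_of_unitary π _ _ (fun b => hιu _) (fun b X => hπR _ X) hC0.le hCπ b
      _ < Cπ * (((c.L ^ n)⁻¹) ^ 2)⁻¹ * (B₃ * (2 * α₀') * (c.L ^ n * c.ξ) ^ 2 * (c.L ^ n)⁻¹ ^ 2) :=
          mul_lt_mul_of_pos_left hY hpos
      _ = Cπ * (B₃ * (2 * α₀') * (c.L ^ n * c.ξ) ^ 2) := by field_simp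

omit [CompleteSpace 𝔸] in
/-- **(1.17) for the `G`-valued factor with print's constants** (`C_π = 1`: `|πX| ≤ |X|`): `|∂U_n(M˙(𝐔_g)) − 1| < B₃2α₀′L⁻²ⁿ(Lⁿξ)²`,
`|J_n(M˙(𝐔_g))| < B₃2α₀′(Lⁿξ)²` on `X̃⁻²` — the shape of v1.2's `eq117_of_inputs` conclusion, from (E1ʳ) ∕ (E2ʳ).
[cite: Balaban1987RG1, (1.17) p.263] -/
theorem eq117_real_of_membership' (π : 𝔸 →ₗ[ℂ] 𝔸) (c : StepConsts) (hL : c.L ≠ 0) (X X₂ : Region P 0)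
    (Λ : (n : ℕ) → Set (Plaq P n)) (hιu : ∀ g, ((D.ι g : 𝔸ˣ) : 𝔸) ∈ unitary 𝔸)
    (hπR : ∀ g X, π (R (D.ι g)⁻¹ X) = R (D.ι g)⁻¹ (π X)) (hπ1 : ∀ X, ‖π X‖ ≤ ‖X‖)
    {B₃ a₁ c₂ α₀' : ℝ}
    (hThm1 : ∀ ε₁ : ℝ, 0 < ε₁ → ε₁ ≤ a₁ → ∀ n, 1 ≤ n → n ≤ c.j → ∀ W : GaugeField P n G,
      (∀ p' ∈ Λ n, ‖((plaq (fun b => D.ι (W b)) p' : 𝔸ˣ) : 𝔸) - 1‖ < ε₁ * (c.L ^ n * c.ξ) ^ 2) →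
      (∀ p ∈ X₂.plaqs, ‖((plaq (fun b => D.ι (D.U n W b)) p : 𝔸ˣ) : 𝔸) - 1‖
          < B₃ * ε₁ * (c.L ^ n * c.ξ) ^ 2 * (c.L ^ n)⁻¹ ^ 2) ∧
      (∀ b ∈ X₂.bonds, ‖divPη (torusT P 0) (dirForm fun b => D.ι (D.U n W b)) (c.L ^ n)⁻¹
          (fun μ ν y => ((plaqU (torusT P 0) (dirForm fun b => D.ι (D.U n W b)) μ ν y : 𝔸ˣ) : 𝔸)) b.dir b.src‖
          < B₃ * ε₁ * (c.L ^ n * c.ξ) ^ 2 * (c.L ^ n)⁻¹ ^ 2 * (c.L ^ n * (c.L ^ n)⁻¹)⁻¹))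
    (havg : ∀ α : ℝ, 0 < α → α ≤ c₂ → ∀ Ug : GaugeField P 0 G,
      (∀ p ∈ X.plaqs, ‖((plaq (fun b => D.ι (Ug b)) p : 𝔸ˣ) : 𝔸) - 1‖ < α * c.ξ ^ 2) →
      ∀ n, 1 ≤ n → n ≤ c.j → ∀ p' ∈ Λ n,
        ‖((plaq (fun b => D.ι (Averaging.iter av n Ug b)) p' : 𝔸ˣ) : 𝔸) - 1‖ < 2 * α * (c.L ^ n * c.ξ) ^ 2)
    (hα : 0 < α₀') (hc₂ : α₀' ≤ c₂) (ha₁ : 2 * α₀' ≤ a₁)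
    (Ug : GaugeField P 0 G) (hUg : ∀ p ∈ X.plaqs, ‖((plaq (fun b => D.ι (Ug b)) p : 𝔸ˣ) : 𝔸) - 1‖ < α₀' * c.ξ ^ 2)
    {n : ℕ} (hn1 : 1 ≤ n) (hnj : n ≤ c.j) :
    (∀ p ∈ X₂.plaqs, ‖((plaq ((D.bgOf π c).Un n (fun b => D.ι (Ug b))) p : 𝔸ˣ) : 𝔸) - 1‖
        < B₃ * (2 * α₀') * (c.L ^ n)⁻¹ ^ 2 * (c.L ^ n * c.ξ) ^ 2) ∧
      (∀ b ∈ X₂.bonds, ‖(D.bgOf π c).Jn n (fun b => D.ι (Ug b)) b‖ < B₃ * (2 * α₀') * (c.L ^ n * c.ξ) ^ 2) := by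
  have h := eq117_real_of_membership D π c hL X X₂ Λ hιu hπR one_pos (fun X => by rw [one_mul]; exact hπ1 X)
    hThm1 havg hα hc₂ ha₁ Ug hUg hn1 hnj
  simpa only [one_mul] using h

end UHalf

end UHalfReal

/-! ## §11 (v1.3). THE COMPLEX SECTOR OF (1.17): §5's `hP9` DERIVED from the [15] §G representation of the continuation
(Prop. 9 ∕ (172)–(173): `U_n(V′V₀) = [e^{iηA}·U_n(V₀)]^u`, `U_n(V₀)` in the clause-(8) space, `A` with (19), `ε₂ = B₅ε₁`) by [I]'s own
expansion (3.11) (`B12Eq311CurrentExpansion.eq311_current`, `B12Eq311RemainderBound.norm_rem311_le_linear`) and §§7–8 -/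

section Complex117

open B12Eq311CurrentExpansion B12Eq311RemainderBound B9Eq369Small

variable {P : Params} {i : ℕ} {𝔸 : Type*} [NormedRing 𝔸] [NormedAlgebra ℂ 𝔸] [StarRing 𝔸] [CStarRing 𝔸]

omit [NormedAlgebra ℂ 𝔸] in
/-- A unit with unitary value and its inverse have norm `≤ 1` (the `ρ = 1` transport bound of [15] §3 for `G`-valued backgrounds;
a unitary has norm `≤ 1` — `= 1` in a non-trivial C⋆-algebra, `0` in the trivial one: the tree's [folklore]
`B10Eq26SiteGauge.norm_le_one_of_mem_unitary`, stated there over `[CStarAlgebra 𝔸]`, here inline in the weaker C⋆-norm context of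
this file). [cite: Balaban1987RG1, p.252] -/
theorem norm_le_one_and_inv_of_mem_unitary {W : 𝔸ˣ} (hW : (W : 𝔸) ∈ unitary 𝔸) :
    ‖(W : 𝔸)‖ ≤ 1 ∧ ‖((W⁻¹ : 𝔸ˣ) : 𝔸)‖ ≤ 1 := by
  have h1 : ∀ u : 𝔸, u ∈ unitary 𝔸 → ‖u‖ ≤ 1 := fun u hu => by
    rcases subsingleton_or_nontrivial 𝔸 with h𝔸 | h𝔸
    · rw [Subsingleton.elim u 0, norm_zero]; exact zero_le_one
    · exact (CStarRing.norm_of_mem_unitary hu).le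
  refine ⟨h1 _ hW, ?_⟩
  rw [Units.inv_eq_of_mul_eq_one_right (Unitary.mul_star_self_of_mem hW)]
  exact h1 _ (Unitary.star_mem hW)

omit [NormedAlgebra ℂ 𝔸] [StarRing 𝔸] [CStarRing 𝔸] in
/-- The plaquette variable of a gauge-transformed configuration is the conjugated plaquette variable («(∂U^u)(p_{μν}(x)) =
R(u(x))(∂U)(p_{μν}(x))», [14] p. 77). [cite: Balaban1985RegularSpaces, (1.11) p.77] -/
theorem plaq_gaugeU_val (u : Site P i → 𝔸ˣ) (U : PBond P i → 𝔸ˣ) (p : Plaq P i) :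
    ((plaq (gaugeU u U) p : 𝔸ˣ) : 𝔸) = R (u p.src) ((plaq U p : 𝔸ˣ) : 𝔸) := by
  rw [plaq_eq_plaqU, plaq_eq_plaqU, dirForm_gaugeU, B9Eq3117Current.plaqU_gaugeTr (torusT P i) (dirForm U) torusT_comm]
  simp only [Units.val_mul, R_def]

omit [NormedAlgebra ℂ 𝔸] [StarRing 𝔸] [CStarRing 𝔸] in
/-- `|∂(U^u)(p) − 1| ≤ ρ_u² |∂U(p) − 1|` for a gauge transformation with `|u(x)|, |u(x)⁻¹| ≤ ρ_u` (a `Gᶜ`-valued `u` near `G`: the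
axial ∕ Landau re-gauging of [15] Prop. 9 is not an isometry off `G`). [cite: Balaban1985RegularSpaces, (1.11) p.77] -/
theorem norm_plaq_gaugeU_sub_one_le (u : Site P i → 𝔸ˣ) {ρu : ℝ} (hu : ∀ x, ‖(u x : 𝔸)‖ ≤ ρu ∧ ‖(((u x)⁻¹ : 𝔸ˣ) : 𝔸)‖ ≤ ρu)
    (U : PBond P i → 𝔸ˣ) (p : Plaq P i) :
    ‖((plaq (gaugeU u U) p : 𝔸ˣ) : 𝔸) - 1‖ ≤ ρu ^ 2 * ‖((plaq U p : 𝔸ˣ) : 𝔸) - 1‖ := by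
  rw [plaq_gaugeU_val]
  have h : R (u p.src) ((plaq U p : 𝔸ˣ) : 𝔸) - 1 = R (u p.src) (((plaq U p : 𝔸ˣ) : 𝔸) - 1) := by
    rw [R_sub, R_apply_one]
  rw [h]
  exact norm_R_le_rho (hu _).1 (hu _).2 _

omit [StarRing 𝔸] [CStarRing 𝔸] in
/-- `|J(U^u)(b)| ≤ ρ_u² |J(U)(b)|` (`J(U^u) = R(u)J(U)`, `B12Eq18Current.current_gaugeU`, for `π` commuting with the rotations by the
values of `u`). [cite: Balaban1987RG1, (1.10) p.262] -/
theorem norm_current_gaugeU_le (π : 𝔸 →ₗ[ℂ] 𝔸) (ξ : ℝ) (u : Site P i → 𝔸ˣ) (hπ : ∀ x X, π (R (u x) X) = R (u x) (π X))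
    {ρu : ℝ} (hu : ∀ x, ‖(u x : 𝔸)‖ ≤ ρu ∧ ‖(((u x)⁻¹ : 𝔸ˣ) : 𝔸)‖ ≤ ρu) (U : PBond P i → 𝔸ˣ) (b : PBond P i) :
    ‖current π ξ (gaugeU u U) b‖ ≤ ρu ^ 2 * ‖current π ξ U b‖ := by
  rw [current_gaugeU π ξ u hπ U b]
  exact norm_R_le_rho (hu _).1 (hu _).2 _

omit [StarRing 𝔸] [CStarRing 𝔸] in
/-- The first-order term of (3.11) under an equivariant bounded `π`: `|D^{ξ*}_U π D^ξ_U 𝐀 (b)| ≤ C_π |(D^{ξ*}_U D^ξ_U 𝐀)(b)|` — the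
third quantity of [15] (19). [cite: Balaban1987RG1, (3.11) p.272] -/
theorem norm_lapCur_le (π : 𝔸 →ₗ[ℂ] 𝔸) (ξ : ℝ) (U : PBond P i → 𝔸ˣ) (A : PBond P i → 𝔸)
    (hπ : ∀ b : PBond P i, ∀ X, π (R (U b)⁻¹ X) = R (U b)⁻¹ (π X)) {Cπ : ℝ} (hCπ : ∀ X, ‖π X‖ ≤ Cπ * ‖X‖)
    (b : PBond P i) :
    ‖lapCur π ξ U A b‖ ≤ Cπ * ‖divPη (torusT P i) (dirForm U) ξ
      (curlη (torusT P i) (dirForm U) ξ (dirForm A)) b.dir b.src‖ := by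
  have hπ' : ∀ μ y X, π (R (dirForm U μ y)⁻¹ X) = R (dirForm U μ y)⁻¹ (π X) := fun μ y X => hπ ⟨y, μ⟩ X
  have h : lapCur π ξ U A b = π (divPη (torusT P i) (dirForm U) ξ
      (curlη (torusT P i) (dirForm U) ξ (dirForm A)) b.dir b.src) := by
    show lapπ (torusT P i) π ξ (dirForm U) (dirForm A) b.dir b.src = _
    exact divPη_linearMap _ _ ξ π hπ' _ _ _
  rw [h]
  exact hCπ _

end Complex117

section Complex117Main

open B12Eq311CurrentExpansion B12Eq311RemainderBound B9Eq369Small B9Eq369Product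

namespace UHalf

variable {P : Params} {G : Type*} [GaugeGroup G] {𝔸 : Type*} [NormedRing 𝔸] [NormedAlgebra ℂ 𝔸] [CompleteSpace 𝔸] [StarRing 𝔸]
  [CStarRing 𝔸] [StarModule ℂ 𝔸] {av : ∀ j, Averaging P j G} (D : UHalf P G 𝔸 av)

omit [GaugeGroup G] [CompleteSpace 𝔸] [StarRing 𝔸] [CStarRing 𝔸] [StarModule ℂ 𝔸] in
/-- The absolute constant `C_F(1)` of the (3.11) remainder bound is non-negative. [cite: Balaban1987RG1, (3.14) p.272] -/
theorem C311_one_nonneg : 0 ≤ C311 (1 : ℝ) := by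
  unfold C311 KI KQ KR
  positivity

/-- **§5's (E1) `hP9` DERIVED FOR THE COMPLEX SECTOR** from the [15] §G REPRESENTATION of the continuation and [I]'s own (3.11).
Print ([15] p. 305 (172)–(173), Prop. 9 p. 309): *«Now let us take V = V′V₀, V₀ satisfies the condition (7), V′ satisfies |V′ − 1| < C₁ε₁ …
We take U₀ = U_k(V₀) … we fix the Landau gauge for the configuration U_k(V′V₀)U₀⁻¹ = U₁, and we have U₁ = exp iη𝓗(B), 𝓗 satisfies the
conditions (19)–(21) with ε₂ = … ≤ 6B₁B₃C₁ε₁ = B₅ε₁. (173)»*, (19) p. 281: *«U₁ = e^{iηA}, |A| < ε₂(Lʲη)⁻¹, |∇^η_{U₀}A| < ε₂(Lʲη)⁻²,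
|D^{η*}_{U₀}D^η_{U₀}A|, |Δ^η_{U₀}A| < ε₂(Lʲη)⁻³ on Ω_j»*, Prop. 9: *«The minimal configuration U_k(V) = U_k(V′V₀) in the axial gauge has
an extension … The function U_k(V′V₀)U_k(V₀)⁻¹ transformed to the Landau gauge is, by the definition, equal to exp iη𝓗(B)»*.
INPUT `hrep` (rows B11.Prop9 · B11.Thm1 · B8.Eq1.7-1.9 BY REFERENCE, on the one-level carrier of §5): for `0 < ε₁ ≤ a₁`,
`1 ≤ n ≤ j` and every `W` on `T⁽ⁿ⁾` with `|∂W − 1| < ε₁(Lⁿξ)²` on `Λ_n`, the [15]-function `extU n W` IS `(e^{iηA}·U₀)^u`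
(`gaugeU u (sub310 η A U₀)`, `η = L⁻ⁿ`) with: `U₀` unitary-valued (the REAL minimiser `U_n(V₀)`) in the clause-(8) space at the top
level — [14] (1.7) `|∂U₀ − 1| < B₃ε₁(Lⁿξ)²L⁻²ⁿ` and (1.9) `|D^{η*}_{U₀}∂U₀| < B₃ε₁(Lⁿξ)²L⁻²ⁿ(Lⁿη)⁻¹` —, `A` with (19) at the top level
with `ε₂ = B₅·ε₁(Lⁿξ)²`, `u` the re-gauging (axial ↔ Landau) with `|u|, |u⁻¹| ≤ ρ_u` (it is `Gᶜ`-valued for complex `W`), and `π`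
commuting with the transports of `U₀` and of `u`.  The passage «M˙(𝐔) = V′V₀ with |V′ − 1| < C₁ε₁» inside print's «From Proposition 9
[15] we obtain» is part of the hypothesis (as it was of `hP9`).  OUTPUT: `hP9` of `eq117_of_inputs` with the EXPLICIT constant
`K = ρ_u²·(C_π(B₃ + B₅ + (d − 1)C_F(1)B₅) + (2B₅ + 8e⁴B₅ + e⁴B₃)) + 1` in place of print's generic `B₃`: the first line by the plaquette
expansion of `e^{iηA}U₀` (`B12Eq311LatticeBounds.norm_plaq_prodCfg_sub_one_le`, [14] (1.26)), the J-line by (3.11)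
`J(e^{iηA}U₀) = J(U₀) + D^{η*}_{U₀}πD^η_{U₀}A + 𝐅(U₀, A)` (`eq311_current`) with `|J(U₀)| ≤ C_π η⁻²|D^{η*}_{U₀}∂U₀|` (§8, [15] (28)),
`|D^{η*}πD^ηA| ≤ C_π|D^{η*}D^ηA|` and the remainder bound `norm_rem311_le_linear`; both lines transported by `u` (`ρ_u²`).
Thresholds: `1 ≤ L`, `0 < ξ`, `Lⁿξ ≤ 1` (`n ≤ j`), `B₃a₁ ≤ 1`, `B₅a₁ ≤ 1`. [cite: Balaban1987RG1, (1.17) p.263] -/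
theorem hP9_of_prop9Shape (π : 𝔸 →ₗ[ℂ] 𝔸) {Cπ : ℝ} (hC0 : 0 < Cπ) (hCπ : ∀ X, ‖π X‖ ≤ Cπ * ‖X‖)
    (c : StepConsts) (hL1 : 1 ≤ c.L) (hξ : 0 < c.ξ) (hLξ : ∀ n, n ≤ c.j → c.L ^ n * c.ξ ≤ 1)
    (X₂ : Region P 0) (Λ : (n : ℕ) → Set (Plaq P n)) {B₃ B₅ a₁ ρu : ℝ} (hB₃ : 0 ≤ B₃) (hB₅ : 0 ≤ B₅) (hρu : 1 ≤ ρu)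
    (ha₁B₃ : B₃ * a₁ ≤ 1) (ha₁B₅ : B₅ * a₁ ≤ 1)
    (hrep : ∀ ε₁ : ℝ, 0 < ε₁ → ε₁ ≤ a₁ → ∀ n, 1 ≤ n → n ≤ c.j → ∀ W : PBond P n → 𝔸ˣ,
      (∀ p' ∈ Λ n, ‖((plaq W p' : 𝔸ˣ) : 𝔸) - 1‖ < ε₁ * (c.L ^ n * c.ξ) ^ 2) →
      ∃ (U₀ : PBond P 0 → 𝔸ˣ) (A : PBond P 0 → 𝔸) (u : Site P 0 → 𝔸ˣ),
        (∀ b, ((U₀ b : 𝔸ˣ) : 𝔸) ∈ unitary 𝔸) ∧ (∀ b X, π (R (U₀ b)⁻¹ X) = R (U₀ b)⁻¹ (π X)) ∧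
        (∀ p : Plaq P 0, ‖((plaq U₀ p : 𝔸ˣ) : 𝔸) - 1‖ < B₃ * ε₁ * (c.L ^ n * c.ξ) ^ 2 * (c.L ^ n)⁻¹ ^ 2) ∧
        (∀ b : PBond P 0, ‖divPη (torusT P 0) (dirForm U₀) (c.L ^ n)⁻¹
            (fun μ ν y => ((plaqU (torusT P 0) (dirForm U₀) μ ν y : 𝔸ˣ) : 𝔸)) b.dir b.src‖
            < B₃ * ε₁ * (c.L ^ n * c.ξ) ^ 2 * (c.L ^ n)⁻¹ ^ 2 * (c.L ^ n * (c.L ^ n)⁻¹)⁻¹) ∧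
        (∀ b, ‖A b‖ < B₅ * ε₁ * (c.L ^ n * c.ξ) ^ 2 * (c.L ^ n * (c.L ^ n)⁻¹)⁻¹) ∧
        (∀ μ ν x, ‖nabla (c.L ^ n)⁻¹ U₀ μ (fun y => A ⟨y, ν⟩) x‖
            < B₅ * ε₁ * (c.L ^ n * c.ξ) ^ 2 * (c.L ^ n * (c.L ^ n)⁻¹)⁻¹ ^ 2) ∧
        (∀ b : PBond P 0, ‖divPη (torusT P 0) (dirForm U₀) (c.L ^ n)⁻¹
            (curlη (torusT P 0) (dirForm U₀) (c.L ^ n)⁻¹ (dirForm A)) b.dir b.src‖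
            < B₅ * ε₁ * (c.L ^ n * c.ξ) ^ 2 * (c.L ^ n * (c.L ^ n)⁻¹)⁻¹ ^ 3) ∧
        (∀ x, ‖(u x : 𝔸)‖ ≤ ρu ∧ ‖(((u x)⁻¹ : 𝔸ˣ) : 𝔸)‖ ≤ ρu) ∧ (∀ x X, π (R (u x) X) = R (u x) (π X)) ∧
        D.extU n W = gaugeU u (sub310 (c.L ^ n)⁻¹ A U₀)) :
    ∀ ε₁ : ℝ, 0 < ε₁ → ε₁ ≤ a₁ → ∀ n, 1 ≤ n → n ≤ c.j → ∀ W : PBond P n → 𝔸ˣ,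
      (∀ p' ∈ Λ n, ‖(↑(plaq W p') : 𝔸) - 1‖ < ε₁ * (c.L ^ n * c.ξ) ^ 2) →
      (∀ p ∈ X₂.plaqs, ‖(↑(plaq (D.extU n W) p) : 𝔸) - 1‖
          < (ρu ^ 2 * (Cπ * (B₃ + B₅ + (P.d - 1) * C311 1 * B₅) + (2 * B₅ + 8 * Real.exp 4 * B₅ + Real.exp 4 * B₃)) + 1)
            * ε₁ * (c.L ^ n)⁻¹ ^ 2 * (c.L ^ n * c.ξ) ^ 2) ∧
      (∀ b ∈ X₂.bonds, ‖current π (c.L ^ n)⁻¹ (D.extU n W) b‖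
          < (ρu ^ 2 * (Cπ * (B₃ + B₅ + (P.d - 1) * C311 1 * B₅) + (2 * B₅ + 8 * Real.exp 4 * B₅ + Real.exp 4 * B₃)) + 1)
            * ε₁ * (c.L ^ n * c.ξ) ^ 2) := by
  intro ε₁ hε₁ hε₁a n hn1 hnj W hW
  obtain ⟨U₀, A, u, hU₀u, hπU₀, h17, h19, hA, hDA, hDDA, hu, hπu, hext⟩ := hrep ε₁ hε₁ hε₁a n hn1 hnj W hW
  -- scales: `η = L⁻ⁿ ≤ 1`, `Lⁿη = 1`, `T := ε₁(Lⁿξ)² ≤ a₁`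
  have hL0 : 0 < c.L := lt_of_lt_of_le one_pos hL1
  have hLn : 0 < c.L ^ n := pow_pos hL0 n
  have hLη : c.L ^ n * (c.L ^ n)⁻¹ = 1 := mul_inv_cancel₀ hLn.ne'
  have hη0 : 0 < (c.L ^ n)⁻¹ := inv_pos.2 hLn
  have hη1 : (c.L ^ n)⁻¹ ≤ 1 := inv_le_one_of_one_le₀ (one_le_pow₀ hL1)
  have hsc1 : (c.L ^ n * c.ξ) ^ 2 ≤ 1 := by
    have h1 := hLξ n hnj
    have h0 : 0 ≤ c.L ^ n * c.ξ := by positivity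
    nlinarith
  have hT0 : 0 < ε₁ * (c.L ^ n * c.ξ) ^ 2 := by positivity
  have hT1 : ε₁ * (c.L ^ n * c.ξ) ^ 2 ≤ a₁ :=
    (mul_le_mul_of_nonneg_left hsc1 hε₁.le).trans (by rw [mul_one]; exact hε₁a)
  have hB₃T : B₃ * (ε₁ * (c.L ^ n * c.ξ) ^ 2) ≤ 1 := (mul_le_mul_of_nonneg_left hT1 hB₃).trans ha₁B₃
  have hB₅T : B₅ * (ε₁ * (c.L ^ n * c.ξ) ^ 2) ≤ 1 := (mul_le_mul_of_nonneg_left hT1 hB₅).trans ha₁B₅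
  have hB₃T0 : 0 ≤ B₃ * (ε₁ * (c.L ^ n * c.ξ) ^ 2) := by positivity
  have hB₅T0 : 0 ≤ B₅ * (ε₁ * (c.L ^ n * c.ξ) ^ 2) := by positivity
  simp only [hLη, inv_one, one_pow, mul_one] at h19 hA hDA hDDA
  -- the letters of the (3.11) files, `ρ = 1`, `a = g = α₂ = B₅T`, `α₀ = B₃T`
  have hU₀1 : ∀ b, ‖(U₀ b : 𝔸)‖ ≤ 1 ∧ ‖(((U₀ b)⁻¹ : 𝔸ˣ) : 𝔸)‖ ≤ 1 :=
    fun b => norm_le_one_and_inv_of_mem_unitary (hU₀u b)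
  have hU₀1' : ∀ μ x, ‖((dirForm U₀ μ x : 𝔸ˣ) : 𝔸)‖ ≤ 1 ∧ ‖(((dirForm U₀ μ x)⁻¹ : 𝔸ˣ) : 𝔸)‖ ≤ 1 :=
    fun μ x => hU₀1 ⟨x, μ⟩
  have hA' : ∀ μ x, ‖dirForm A μ x‖ ≤ B₅ * (ε₁ * (c.L ^ n * c.ξ) ^ 2) := fun μ x => by
    rw [dirForm_apply]
    have h := (hA ⟨x, μ⟩).le
    simpa only [mul_assoc] using h
  have hAb : ∀ b, ‖A b‖ ≤ B₅ * (ε₁ * (c.L ^ n * c.ξ) ^ 2) := fun b => by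
    have h := (hA b).le
    simpa only [mul_assoc] using h
  have hDAn : ∀ μ ν x, ‖nabla (c.L ^ n)⁻¹ U₀ μ (fun y => A ⟨y, ν⟩) x‖ ≤ B₅ * (ε₁ * (c.L ^ n * c.ξ) ^ 2) :=
    fun μ ν x => by
      have h := (hDA μ ν x).le
      simpa only [mul_assoc] using h
  have hDA' : ∀ κ ν y, ‖covD (torusT P 0) (dirForm U₀) κ (dirForm A ν) y‖
      ≤ (c.L ^ n)⁻¹ * (B₅ * (ε₁ * (c.L ^ n * c.ξ) ^ 2)) := by
    intro κ ν y
    have h := hDAn κ ν y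
    rw [nabla_eq_smul_covD, norm_eta_inv_smul_le_iff hη0] at h
    exact h
  have hDDA' : ∀ b : PBond P 0, ‖divPη (torusT P 0) (dirForm U₀) (c.L ^ n)⁻¹
      (curlη (torusT P 0) (dirForm U₀) (c.L ^ n)⁻¹ (dirForm A)) b.dir b.src‖ ≤ B₅ * (ε₁ * (c.L ^ n * c.ξ) ^ 2) :=
    fun b => by
      have h := (hDDA b).le
      simpa only [mul_assoc] using h
  have hP17 : ∀ p : Plaq P 0, ‖((plaq U₀ p : 𝔸ˣ) : 𝔸) - 1‖ ≤ B₃ * (ε₁ * (c.L ^ n * c.ξ) ^ 2) * (c.L ^ n)⁻¹ ^ 2 :=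
    fun p => by
      have h := (h17 p).le
      simpa only [mul_assoc] using h
  have he4 : Real.exp ((c.L ^ n)⁻¹ * (2 * (1 + (1:ℝ) ^ 2) * (B₅ * (ε₁ * (c.L ^ n * c.ξ) ^ 2)))) ≤ Real.exp 4 := by
    apply Real.exp_le_exp.mpr
    nlinarith
  have hd : (0:ℝ) ≤ P.d - 1 := by
    have : (1:ℝ) ≤ P.d := by exact_mod_cast P.hd
    linarith
  have hC := C311_one_nonneg
  refine ⟨fun p hp => ?_, fun b hb => ?_⟩
  · -- FIRST LINE: |∂((e^{iηA}U₀)^u)(p) − 1| ≤ ρ_u²·η²·T·(2B₅ + 8e⁴B₅ + e⁴B₃) < K·T·η²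
    rw [hext]
    have hpl : ‖((plaq (sub310 (c.L ^ n)⁻¹ A U₀) p : 𝔸ˣ) : 𝔸) - 1‖
        ≤ (c.L ^ n)⁻¹ ^ 2 * (2 * (B₅ * (ε₁ * (c.L ^ n * c.ξ) ^ 2))
            + 1 / 2 * (2 * (1 + (1:ℝ) ^ 2) * (B₅ * (ε₁ * (c.L ^ n * c.ξ) ^ 2))) ^ 2
              * Real.exp ((c.L ^ n)⁻¹ * (2 * (1 + (1:ℝ) ^ 2) * (B₅ * (ε₁ * (c.L ^ n * c.ξ) ^ 2))))
            + Real.exp ((c.L ^ n)⁻¹ * (2 * (1 + (1:ℝ) ^ 2) * (B₅ * (ε₁ * (c.L ^ n * c.ξ) ^ 2))))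
              * ((B₃ * (ε₁ * (c.L ^ n * c.ξ) ^ 2) * (c.L ^ n)⁻¹ ^ 2) / (c.L ^ n)⁻¹ ^ 2)) := by
      rw [plaq_eq_plaqU, dirForm_sub310]
      exact B12Eq311LatticeBounds.norm_plaq_prodCfg_sub_one_le (torusT P 0) (dirForm U₀) hη0 hU₀1' hA' hDA'
        p.μ p.ν p.src (by rw [← plaq_eq_plaqU]; exact hP17 p)
    -- the bracket is ≤ T·(2B₅ + 8e⁴B₅ + e⁴B₃)
    have hx2 : (B₅ * (ε₁ * (c.L ^ n * c.ξ) ^ 2)) ^ 2 ≤ B₅ * (ε₁ * (c.L ^ n * c.ξ) ^ 2) := by nlinarith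
    have e0 : 0 ≤ Real.exp ((c.L ^ n)⁻¹ * (2 * (1 + (1:ℝ) ^ 2) * (B₅ * (ε₁ * (c.L ^ n * c.ξ) ^ 2)))) :=
      (Real.exp_pos _).le
    have hdiv : (B₃ * (ε₁ * (c.L ^ n * c.ξ) ^ 2) * (c.L ^ n)⁻¹ ^ 2) / (c.L ^ n)⁻¹ ^ 2
        = B₃ * (ε₁ * (c.L ^ n * c.ξ) ^ 2) := by field_simp
    have h2 := mul_le_mul hx2 he4 e0 hB₅T0
    have h3 := mul_le_mul_of_nonneg_right he4 hB₃T0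
    have hbr : 2 * (B₅ * (ε₁ * (c.L ^ n * c.ξ) ^ 2))
            + 1 / 2 * (2 * (1 + (1:ℝ) ^ 2) * (B₅ * (ε₁ * (c.L ^ n * c.ξ) ^ 2))) ^ 2
              * Real.exp ((c.L ^ n)⁻¹ * (2 * (1 + (1:ℝ) ^ 2) * (B₅ * (ε₁ * (c.L ^ n * c.ξ) ^ 2))))
            + Real.exp ((c.L ^ n)⁻¹ * (2 * (1 + (1:ℝ) ^ 2) * (B₅ * (ε₁ * (c.L ^ n * c.ξ) ^ 2))))
              * ((B₃ * (ε₁ * (c.L ^ n * c.ξ) ^ 2) * (c.L ^ n)⁻¹ ^ 2) / (c.L ^ n)⁻¹ ^ 2)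
        ≤ (ε₁ * (c.L ^ n * c.ξ) ^ 2) * (2 * B₅ + 8 * Real.exp 4 * B₅ + Real.exp 4 * B₃) := by
      rw [hdiv]
      nlinarith [h2, h3]
    have hfirst : ‖((plaq (gaugeU u (sub310 (c.L ^ n)⁻¹ A U₀)) p : 𝔸ˣ) : 𝔸) - 1‖
        ≤ ρu ^ 2 * ((c.L ^ n)⁻¹ ^ 2 * ((ε₁ * (c.L ^ n * c.ξ) ^ 2) * (2 * B₅ + 8 * Real.exp 4 * B₅ + Real.exp 4 * B₃))) :=
      (norm_plaq_gaugeU_sub_one_le u hu _ p).trans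
        (mul_le_mul_of_nonneg_left (hpl.trans (mul_le_mul_of_nonneg_left hbr (sq_nonneg _))) (sq_nonneg ρu))
    refine hfirst.trans_lt ?_
    have hgap : 0 < (ρu ^ 2 * (Cπ * (B₃ + B₅ + (P.d - 1) * C311 1 * B₅)) + 1)
        * (ε₁ * (c.L ^ n)⁻¹ ^ 2 * (c.L ^ n * c.ξ) ^ 2) := by positivity
    have hid : (ρu ^ 2 * (Cπ * (B₃ + B₅ + (P.d - 1) * C311 1 * B₅) + (2 * B₅ + 8 * Real.exp 4 * B₅ + Real.exp 4 * B₃)) + 1)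
            * ε₁ * (c.L ^ n)⁻¹ ^ 2 * (c.L ^ n * c.ξ) ^ 2
        = ρu ^ 2 * ((c.L ^ n)⁻¹ ^ 2 * ((ε₁ * (c.L ^ n * c.ξ) ^ 2) * (2 * B₅ + 8 * Real.exp 4 * B₅ + Real.exp 4 * B₃)))
          + (ρu ^ 2 * (Cπ * (B₃ + B₅ + (P.d - 1) * C311 1 * B₅)) + 1) * (ε₁ * (c.L ^ n)⁻¹ ^ 2 * (c.L ^ n * c.ξ) ^ 2) := by
      ring
    rw [hid]
    linarith
  · -- J-LINE: |J((e^{iηA}U₀)^u)(b)| ≤ ρ_u²(|J(U₀)| + |D*πDA| + |𝐅|) < K·T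
    rw [hext]
    have hJ0 : ‖current π (c.L ^ n)⁻¹ U₀ b‖ < Cπ * (B₃ * (ε₁ * (c.L ^ n * c.ξ) ^ 2)) := by
      have hY := h19 b
      have hpos : 0 < Cπ * (((c.L ^ n)⁻¹) ^ 2)⁻¹ := mul_pos hC0 (by positivity)
      calc ‖current π (c.L ^ n)⁻¹ U₀ b‖
          ≤ Cπ * (((c.L ^ n)⁻¹) ^ 2)⁻¹ * ‖divPη (torusT P 0) (dirForm U₀) (c.L ^ n)⁻¹
              (fun μ ν y => ((plaqU (torusT P 0) (dirForm U₀) μ ν y : 𝔸ˣ) : 𝔸)) b.dir b.src‖ :=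
            norm_current_le_of_unitary π _ U₀ hU₀u hπU₀ hC0.le hCπ b
        _ < Cπ * (((c.L ^ n)⁻¹) ^ 2)⁻¹ * (B₃ * ε₁ * (c.L ^ n * c.ξ) ^ 2 * (c.L ^ n)⁻¹ ^ 2) :=
            mul_lt_mul_of_pos_left hY hpos
        _ = Cπ * (B₃ * (ε₁ * (c.L ^ n * c.ξ) ^ 2)) := by field_simp
    have hlap : ‖lapCur π (c.L ^ n)⁻¹ U₀ A b‖ ≤ Cπ * (B₅ * (ε₁ * (c.L ^ n * c.ξ) ^ 2)) :=
      (norm_lapCur_le π _ U₀ A hπU₀ hCπ b).trans (mul_le_mul_of_nonneg_left (hDDA' b) hC0.le)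
    have hrem : ‖rem311 π (c.L ^ n)⁻¹ U₀ A b‖ ≤ (P.d - 1) * (Cπ * C311 1 * (B₅ * (ε₁ * (c.L ^ n * c.ξ) ^ 2))) :=
      norm_rem311_le_linear (ρ := 1) hη0 hη1 le_rfl hU₀1 hB₃T0 hB₃T hB₅T hAb hDAn hP17 hC0.le hCπ hπU₀ b
    have hJ' : ‖current π (c.L ^ n)⁻¹ (sub310 (c.L ^ n)⁻¹ A U₀) b‖
        ≤ Cπ * (B₃ * (ε₁ * (c.L ^ n * c.ξ) ^ 2)) + Cπ * (B₅ * (ε₁ * (c.L ^ n * c.ξ) ^ 2))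
          + (P.d - 1) * (Cπ * C311 1 * (B₅ * (ε₁ * (c.L ^ n * c.ξ) ^ 2))) := by
      rw [eq311_current]
      exact (norm_add_le _ _).trans (add_le_add ((norm_add_le _ _).trans (add_le_add hJ0.le hlap)) hrem)
    have hJu : ‖current π (c.L ^ n)⁻¹ (gaugeU u (sub310 (c.L ^ n)⁻¹ A U₀)) b‖
        ≤ ρu ^ 2 * (Cπ * (B₃ * (ε₁ * (c.L ^ n * c.ξ) ^ 2)) + Cπ * (B₅ * (ε₁ * (c.L ^ n * c.ξ) ^ 2))
          + (P.d - 1) * (Cπ * C311 1 * (B₅ * (ε₁ * (c.L ^ n * c.ξ) ^ 2)))) :=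
      (norm_current_gaugeU_le π _ u hπu hu _ b).trans (mul_le_mul_of_nonneg_left hJ' (sq_nonneg ρu))
    refine hJu.trans_lt ?_
    have hgap : 0 < (ρu ^ 2 * (2 * B₅ + 8 * Real.exp 4 * B₅ + Real.exp 4 * B₃) + 1)
        * (ε₁ * (c.L ^ n * c.ξ) ^ 2) := by positivity
    have hid : (ρu ^ 2 * (Cπ * (B₃ + B₅ + (P.d - 1) * C311 1 * B₅) + (2 * B₅ + 8 * Real.exp 4 * B₅ + Real.exp 4 * B₃)) + 1)
            * ε₁ * (c.L ^ n * c.ξ) ^ 2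
        = ρu ^ 2 * (Cπ * (B₃ * (ε₁ * (c.L ^ n * c.ξ) ^ 2)) + Cπ * (B₅ * (ε₁ * (c.L ^ n * c.ξ) ^ 2))
            + (P.d - 1) * (Cπ * C311 1 * (B₅ * (ε₁ * (c.L ^ n * c.ξ) ^ 2))))
          + (ρu ^ 2 * (2 * B₅ + 8 * Real.exp 4 * B₅ + Real.exp 4 * B₃) + 1) * (ε₁ * (c.L ^ n * c.ξ) ^ 2) := by
      ring
    rw [hid]
    linarith

/-- **(1.17) FOR THE ASSEMBLED DATUM WITH NO (1.17)-SHAPED HYPOTHESIS**: §5's `eq117_of_inputs` BY NAME, its input (E1) `hP9` now the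
THEOREM `hP9_of_prop9Shape` — so (1.17) for `bgOf` (both lines, every `1 ≤ n ≤ j`, on `X̃⁻²`, for every `V` with `|∂V − 1| < α₀′ξ²`
on `X`) follows from: the [15] §G representation of the continuation with the clause-(8) ∕ (19) bounds (`hrep`, rows B11.Prop9 ·
B11.Thm1 · B8.Eq1.7-1.9 by reference), the averaging bound (E2) `havg` ([12] Prop. 2, row B7.Prop2 by reference), [I]'s own (3.11)
(tree theorems) and the thresholds; print's generic `B₃` of (1.17) is the explicit `K` of `hP9_of_prop9Shape`.
[cite: Balaban1987RG1, (1.17) p.263] -/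
theorem eq117_of_prop9Shape (π : 𝔸 →ₗ[ℂ] 𝔸) {Cπ : ℝ} (hC0 : 0 < Cπ) (hCπ : ∀ X, ‖π X‖ ≤ Cπ * ‖X‖)
    (c : StepConsts) (hL1 : 1 ≤ c.L) (hξ : 0 < c.ξ) (hLξ : ∀ n, n ≤ c.j → c.L ^ n * c.ξ ≤ 1)
    (X X₂ : Region P 0) (Λ : (n : ℕ) → Set (Plaq P n)) {B₃ B₅ a₁ ρu c₂ α₀' : ℝ} (hB₃ : 0 ≤ B₃) (hB₅ : 0 ≤ B₅)
    (hρu : 1 ≤ ρu) (ha₁B₃ : B₃ * a₁ ≤ 1) (ha₁B₅ : B₅ * a₁ ≤ 1)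
    (hrep : ∀ ε₁ : ℝ, 0 < ε₁ → ε₁ ≤ a₁ → ∀ n, 1 ≤ n → n ≤ c.j → ∀ W : PBond P n → 𝔸ˣ,
      (∀ p' ∈ Λ n, ‖((plaq W p' : 𝔸ˣ) : 𝔸) - 1‖ < ε₁ * (c.L ^ n * c.ξ) ^ 2) →
      ∃ (U₀ : PBond P 0 → 𝔸ˣ) (A : PBond P 0 → 𝔸) (u : Site P 0 → 𝔸ˣ),
        (∀ b, ((U₀ b : 𝔸ˣ) : 𝔸) ∈ unitary 𝔸) ∧ (∀ b X, π (R (U₀ b)⁻¹ X) = R (U₀ b)⁻¹ (π X)) ∧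
        (∀ p : Plaq P 0, ‖((plaq U₀ p : 𝔸ˣ) : 𝔸) - 1‖ < B₃ * ε₁ * (c.L ^ n * c.ξ) ^ 2 * (c.L ^ n)⁻¹ ^ 2) ∧
        (∀ b : PBond P 0, ‖divPη (torusT P 0) (dirForm U₀) (c.L ^ n)⁻¹
            (fun μ ν y => ((plaqU (torusT P 0) (dirForm U₀) μ ν y : 𝔸ˣ) : 𝔸)) b.dir b.src‖
            < B₃ * ε₁ * (c.L ^ n * c.ξ) ^ 2 * (c.L ^ n)⁻¹ ^ 2 * (c.L ^ n * (c.L ^ n)⁻¹)⁻¹) ∧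
        (∀ b, ‖A b‖ < B₅ * ε₁ * (c.L ^ n * c.ξ) ^ 2 * (c.L ^ n * (c.L ^ n)⁻¹)⁻¹) ∧
        (∀ μ ν x, ‖nabla (c.L ^ n)⁻¹ U₀ μ (fun y => A ⟨y, ν⟩) x‖
            < B₅ * ε₁ * (c.L ^ n * c.ξ) ^ 2 * (c.L ^ n * (c.L ^ n)⁻¹)⁻¹ ^ 2) ∧
        (∀ b : PBond P 0, ‖divPη (torusT P 0) (dirForm U₀) (c.L ^ n)⁻¹
            (curlη (torusT P 0) (dirForm U₀) (c.L ^ n)⁻¹ (dirForm A)) b.dir b.src‖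
            < B₅ * ε₁ * (c.L ^ n * c.ξ) ^ 2 * (c.L ^ n * (c.L ^ n)⁻¹)⁻¹ ^ 3) ∧
        (∀ x, ‖(u x : 𝔸)‖ ≤ ρu ∧ ‖(((u x)⁻¹ : 𝔸ˣ) : 𝔸)‖ ≤ ρu) ∧ (∀ x X, π (R (u x) X) = R (u x) (π X)) ∧
        D.extU n W = gaugeU u (sub310 (c.L ^ n)⁻¹ A U₀))
    (havg : ∀ α : ℝ, 0 < α → α ≤ c₂ → ∀ V : PBond P 0 → 𝔸ˣ, (∀ p ∈ X.plaqs, ‖(↑(plaq V p) : 𝔸) - 1‖ < α * c.ξ ^ 2) →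
      ∀ n, 1 ≤ n → n ≤ c.j → ∀ p' ∈ Λ n, ‖(↑(plaq (D.extM n V) p') : 𝔸) - 1‖ < 2 * α * (c.L ^ n * c.ξ) ^ 2)
    (hα : 0 < α₀') (hc₂ : α₀' ≤ c₂) (ha₁ : 2 * α₀' ≤ a₁) :
    ∀ V : PBond P 0 → 𝔸ˣ, (∀ p ∈ X.plaqs, ‖(↑(plaq V p) : 𝔸) - 1‖ < α₀' * c.ξ ^ 2) → ∀ n, 1 ≤ n → n ≤ c.j →
      (∀ p ∈ X₂.plaqs, ‖(↑(plaq ((D.bgOf π c).Un n V) p) : 𝔸) - 1‖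
          < (ρu ^ 2 * (Cπ * (B₃ + B₅ + (P.d - 1) * C311 1 * B₅) + (2 * B₅ + 8 * Real.exp 4 * B₅ + Real.exp 4 * B₃)) + 1)
            * (2 * α₀') * (c.L ^ n)⁻¹ ^ 2 * (c.L ^ n * c.ξ) ^ 2) ∧
      (∀ b ∈ X₂.bonds, ‖(D.bgOf π c).Jn n V b‖
          < (ρu ^ 2 * (Cπ * (B₃ + B₅ + (P.d - 1) * C311 1 * B₅) + (2 * B₅ + 8 * Real.exp 4 * B₅ + Real.exp 4 * B₃)) + 1)
            * (2 * α₀') * (c.L ^ n * c.ξ) ^ 2) :=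
  D.eq117_of_inputs π c X X₂ Λ (D.hP9_of_prop9Shape π hC0 hCπ c hL1 hξ hLξ X₂ Λ hB₃ hB₅ hρu ha₁B₃ ha₁B₅ hrep) havg hα hc₂ ha₁

end UHalf

end Complex117Main

end

end Literature.MathematicalPhysics.QuantumFieldTheory.Balaban1983to89.B12Eq115BackgroundPair
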